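/-
Copyright (c) 2026 the pub-hodgecm-mathlib formalisation cell (harness21).  Assembler seat hodgecm-mathlib-F0P3a-p01 (g30) (heir LEAD F0P3a-plan T17-31 (R-9): «U3∕U4 assembler =
F0P3a-p01 lineage»; dealer LH4-plan (g10) WORD #15∕#16; desk F0P3-plan (g21) TIER-1 INVENTORY v1.1 §U3).  2026-09-03.
-/
import Summits.HodgeConjecture.HodgeConjecture.Theorems.F0P3cDyRamFourFrameLawDefs     -- ★ DEFS LEAF №1 «LAW-DEFS» (p854575): `StableLawAt`, `KappaAmplitudeLawAt`, `KappaSignLawAt`, `DyadicFence`,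
                                                                                      -- `FourFrameLawsWildAt`, `FourFrameLawsWild`, `FourFrameLawsWildOfRecord`; brings ★ #0a `UnitaryThreeFourFrameDefs`
import Summits.HodgeConjecture.HodgeConjecture.Theorems.F0P3cDyRamFourFrameLawDefsR    -- DEFS LEAF №1-R (RC-1, LEAD T18-06 (R-16); p855074): `KappaAmplitudeLawAtR∕KappaSignLawAtR`, `…AtS shift`, `FourFrameLawsWildOfRecordR`, `shiftR`
import Summits.HodgeConjecture.HodgeConjecture.Theorems.F0P3cDyRamFourFrameCensusDefs   -- ★ U2G DEFS LEAF (B-p08 (g41)): `fixedEdgeCount` — the (K-1)(c) edge-law currency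
import Summits.HodgeConjecture.HodgeConjecture.Theorems.F0P3cDyRamU3EdgeLawT2           -- ★ p854902 (LH4-p09 (g0)): `edgeLaw_t2` — PAYS `stub_U3_edgeLaw_t2` ((K-1)(c) edge identity: fenced wild tree + Euler count of the fixed subtree)
import Summits.HodgeConjecture.HodgeConjecture.Theorems.F0P3cDyRamStableLawOfModelSum   -- ★ p855240 (LH4-p10 (g0)): `stableLawAt_of_normIndexTwo_of_modelSum` — PAYS `stub_U3_stableLaw_RP∕_RU` BY COMPOSITION from §S-R (NI2) + (MS) ((R-17) «NI2 ⊕ MS»); brings ★ p855115, ★ p855032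
import Summits.HodgeConjecture.HodgeConjecture.Theorems.F0P3cDyRamNormIndexTwo   -- ★ p855402 (F0P3-p01 (g30); legs ★ p855352 + ★ p855374 LH4-p09 (g2)): `normIndexTwo` = NI2 :86 token for token — ED. 5 paydown
import Summits.HodgeConjecture.HodgeConjecture.Theorems.F0P3cDyRamKappaAbsLawOfKappaModelSum   -- ★ p855529 (F0P3-p01 (g30); over ★ p855506, ★ p855505 LH4-p09 (g2), ★ p855402 NI2): `dyadicFence_kappaAmplitudeLawAtR_of_kappaModelSum8` — PAYS `stub_U3_kappaAbsLawR` BY COMPOSITION from (KMS) ((R-18) «K-ABS-R := NI2 ⊕ KMS»)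
import Summits.HodgeConjecture.HodgeConjecture.Theorems.F0P3cDyRamKappaSignLawR2OfKappaSignModelSum  -- ★ p856997 (LH4-p10 (g3); (R-22)(iii), over ★ NI2 p855402 + ★ p855598's algebra): `dyadicFence_kappaSignLawAtR2_of_kappaSignModelSum2_8 Ω` — PAYS `stub_U3_kappaSignLawR2` BY COMPOSITION from (KSS²) («K-SGN-R2 := NI2 ⊕ KSS²»); brings ★ DEFS LEAF №1-R2 p856987 (`OmegaSchedule`, `KappaSignLawAtR2`, `FourFrameLawsWildOfRecordR2`).  ED. 13: replaces the import of ★ p855598 (payer of the STRUCK `stub_U3_kappaSignLawR`)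
import Summits.HodgeConjecture.HodgeConjecture.Theorems.F0P3cDyRamStableModelSumOfStageB  -- ★ p856175 + ED. 2 (LH4-p11 (g2)): `stableModelSum_of_stageB_mult (hB10) (hA₂) (hB10₂)` — PAYS `stub_U3_stableModelSum` BY COMPOSITION from ★ B10 (type 0) + (MS-A₂) + (MS-B₂) (ED. 8 «MS-SPLIT», (R-21) re-key of the type-2 half on multiplicity); brings ★ (O2c) p856135 + ED. 2, ★ StrataDefs ED. 3 `polarisationCount`
import Summits.HodgeConjecture.HodgeConjecture.Theorems.F0P3cDyRamDiagonalOrbitCount        -- ★ p856135 + ED. 2 (LH4-p11 (g2); over ★ (O2b)-MULT M1–M3 p856360∕p856385∕p856421 LH4-p14 (g2), ★ engine p856016∕p856302): `sum_ncard_fixed_vertices_eq_eight_mul_finsum_polarisationCount_mul_stabiliserWeight` — PAYS (MS-A₂) `stub_U3_stageA_typeTwo_mult` BY NAME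
import Summits.HodgeConjecture.HodgeConjecture.Theorems.F0P3cDyRamStableCountTypeZero        -- ★ (LH4-p10 (g2); B10 over ★ B0–B8, PART 1∕2, B3∕B4∕§P∕B56∕B7 sockets of the whole squad): `finsum_stabiliserWeight_dualisable_eq` — the TYPE-0 STABLE COUNT `[k]_q`, the `hB10` input of the (MS) composition
import Summits.HodgeConjecture.HodgeConjecture.Theorems.F0P3cDyRamStableCountTypeTwo         -- ★ (LH4-p10 (g2); B10₂-MULT over ★ generic p856349 + sockets₂-MULT T p856520 (p13) · G1 p856576 (F0P3-p01) + §P₂ p856500 (p13) · H p856639 (p07 (g4)) · shapes₂ p856358 (p04) · StrataDefs ED. 3): `finsum_polarisationCount_mul_stabiliserWeight_eq` — PAYS (MS-B₂) `stub_U3_stableCount_typeTwo_mult` BY NAME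
import Summits.HodgeConjecture.HodgeConjecture.Theorems.F0P3cDyRamKappaModelSumOfKappaStageB      -- ★ p856604 ∕ ED. 2 p856682 (LH4-p05 (g3)): `kappaModelSum_of_kappaStageB_complete (hAκ2) (hBκ10) (hBκ10₂)` — PAYS `stub_U3_kappaModelSum` (KMS) BY COMPOSITION (ED. 10); brings ★ (Oκ2c)₀ p856579, ★ KappaCountDefs p856497
import Summits.HodgeConjecture.HodgeConjecture.Theorems.F0P3cDyRamKappaSignModelSum2OfKappaStageB -- ★ p856996 (LH4-p05 (g4); (R-22)(iv), over the ★ sign-token-generic engine p856977): `kappaSignModelSum2_of_kappaStageB_complete Ω (hAκ2) (hBκS20) (hBκS20₂)` — PAYS `stub_U3_kappaSignModelSum2` (KSS²) BY COMPOSITION.  ED. 13: replaces the import of ★ p856605∕p856683 (payer of the STRUCK KSS)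
import Summits.HodgeConjecture.HodgeConjecture.Theorems.F0P3cDyRamOmegaRDefs          -- ★ (R-22) DEFS LEAF «the schedule of record»: `omegaR : OmegaSchedule`, `omegaR K σ ϖ d a b i = glueSignR σ ϖ d a b i` (LH4-p10 (g3) OMEGA-R-INSTANTIATION v1 over ★ LH4-p04 (g2) Ω leaf p856975); brings ★ `…GlueSignDefs`, ★ `…LawDefsR2`
import Summits.HodgeConjecture.HodgeConjecture.Theorems.F0P3cDyRamDiagonalKappaOrbitCountMult     -- ★ p856633 (LH4-p05 (g3); over ★ (Oκ2b)-MULT p856607, ★ p14 M1–M3): `kappaStageA_typeTwo_mult` — PAYS (κ-A₂) `stub_U3_kappaStageA_typeTwo_mult` AT BIRTH BY NAME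
import Summits.HodgeConjecture.HodgeConjecture.Theorems.F0P3cDyRamKappaCountTypeZeroPaid           -- ★ p856938 (F0P3a-p01 (g32); := ★ p856859 `kappaCount_typeZero_of_boxSum` over ★ p856906 κ-BOX-SUM `sum_box_kappa_eq_typeZero` (LH4-p14 (g3))): `kappaCount_typeZero` — PAYS (κ-B₀) `stub_U3_kappaCount_typeZero` BY NAME (ED. 11)
import Summits.HodgeConjecture.HodgeConjecture.Theorems.F0P3cDyRamKappaCountTypeTwoPaid            -- ★ p856993 (LH4-p11 (g3); := ★ p856967 `kappaCount_typeTwo_mult_of_boxSum` over ★ p856964 κ-BOX-SUM₂ `sum_box_kappa_eq_typeTwo` (LH4-p11 (g3))): `kappaCount_typeTwo_mult` — PAYS (κ-B₂) `stub_U3_kappaCount_typeTwo_mult` BY NAME (ED. 12)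
import Summits.HodgeConjecture.HodgeConjecture.Theorems.F0P3cDyRamKappaSignCount2TypeZero  -- ★ p857128 (LH4-p04 (g3); (κS-B₀²) PAYER of plan b501bd1f (heir LEAD T18-59 GO): := ★ (A) p857082 `finsum_kappaCount_typeZero_eq_token_mul_ampl` (LH4-p05 (g4)) ⊕ ★ (C0) p857084 (LH4-p06 (g4)) ⊕ ★ (C1) p857107 Ω-token rotations (LH4-p04 (g3)); §0 `exists_isGlueRep_of_le_depth` ∕ `exists_isGlueRep_of_ampl_ne_zero` «junk never read»): `kappaSignCount2_typeZero` — PAYS (κS-B₀²) `stub_U3_kappaSignCount2_typeZero` BY NAME (ED. 14)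
import Summits.HodgeConjecture.HodgeConjecture.Theorems.F0P3cDyRamKappaSignCount2TypeTwoMult  -- ★ p857148 (LH4-p07 (g6); (κS-B₂²) PAYER of plan b501bd1f type 2 (heir LEAD T18-59 (d), T18-53 Q5 type-blind Ω factor): := ★ (A₂) p857083 `finsum_kappaCount_typeTwo_eq_token_mul_ampl` (LH4-p05 (g4)) ⊕ ★ (C0) p857084 (LH4-p06 (g4)) ⊕ ★ (C1) p857107 + ★ (D) §0 `exists_isGlueRep_of_le_depth` p857128 (LH4-p04 (g3)); §1 `exists_isGlueRep_of_ampl_typeTwo_ne_zero` «junk never read» at `B + tauOfRecord d`): `kappaSignCount2_typeTwo_mult` — PAYS (κS-B₂²) `stub_U3_kappaSignCount2_typeTwo_mult` BY NAME (ED. 15)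
import HarnessLib

/-!
# Crux `H413`, line «(D-RAM) FOUR-FRAME» `Cruxes/H413/Lines/F0_P3c_DyRamFourFrame.lean` — TIER-1 MODULE `U3_Laws` (unit (iii): the FOUR-FRAME CENSUS LAWS, cut place-wise),
# ED. 15 («(κS-B₂²) PAID BY NAME», dealer∕pen∕cutter LH4-plan (g12); heir LEAD F0P3a-plan (g19) T18-59 (d) «type 2 (κS-B₂²) = (A₂) ⊕ the SAME (C0)(C1) ⊕ (D₂) → ED. 15») = ED. 14 + (κS-B₂²) `stub_U3_kappaSignCount2_typeTwo_mult` PAID BY NAME (theorem line over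
# ★ `F0P3cDyRamKappaSignCount2TypeTwoMult.kappaSignCount2_typeTwo_mult` p857148, LH4-p07 (g6): ★ TRUNK (A₂) p857083 at the three ★ glue witnesses, dead axis ⇒ `ampl = 0` (junk Ω never read, §1 `exists_isGlueRep_of_ampl_typeTwo_ne_zero` over ★ (D) §0 `exists_isGlueRep_of_le_depth`), alive axis ⇒ ★ (C0) p857084 ∕ ★ (C1) p857107 token = law token at `omegaR`,
# multiplicity `B + tauOfRecord d`; no `Ω = 1`, no covered-set guard, no (d,t) split — LEAD T18-59 (b)(i)–(v) met (Ω-reader LH4-p10 (g3) FINAL «=», tie LH4-p11 (g4), TYPE #4175340715 REF1 #205)); names + TYPES of every standing decl unchanged (body swap only); ⇒ (KSS²) `stub_U3_kappaSignModelSum2`, (K-SGN-R2) `stub_U3_kappaSignLawR2` and the R2 cone are KERNEL-CLOSED (TRIO); THIS MODULE HAS NO `sorry` LEFT.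
# ED. 14 («(κS-B₀²) PAID BY NAME», dealer∕pen∕cutter LH4-plan (g12); heir LEAD F0P3a-plan (g19) T18-59 (d) «after (D) is ★ + BUILT: U3 ED. 14, body = bare constant, the ED. 11∕12 pattern») = ED. 13 + (κS-B₀²) `stub_U3_kappaSignCount2_typeZero` PAID BY NAME (theorem line over
# ★ `F0P3cDyRamKappaSignCount2TypeZero.kappaSignCount2_typeZero` p857128, LH4-p04 (g3): ★ TRUNK (A) p857082 at the three ★ glue witnesses, dead axis ⇒ `ampl = 0` (junk Ω never read, §0 `exists_isGlueRep_of_ampl_ne_zero`), alive axis ⇒ ★ (C0) p857084 ∕ ★ (C1) p857107 token = law token at `omegaR`;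
# no `Ω = 1`, no covered-set guard, no (d,t) split — LEAD T18-59 (b)(i)–(v) met (Ω-reader LH4-p10 (g3) «=», (F1)(F2) REF5 R5-138)); names + TYPES of every standing decl unchanged (body swap only); ⇒ (KSS²)∕(K-SGN-R2) depend on ONE sorry; sorries = {(κS-B₂²) `stub_U3_kappaSignCount2_typeTwo_mult`} ((D₂) LH4-p07 (g6) in flight → ED. 15).
# ED. 13 («κS-RECUT (R-22)» = heir LEAD T18-53's «ED. 11b», heir LEAD F0P3a-plan (g19) T18-53 ORDER OF SHAPE (Q1 OPTION A in LH4-p10 (g3)'s schedule-parameter typing, Q2 STRIKE-and-leave, Q5 one factor for both vertex types); cutter LH4-p05 (g4), pen∕dealer LH4-plan (g12); BASE fdb2e3478fe7f0a9) =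
# BASE − THE STRUCK CONE + §K-R2.  STRUCK AND REMOVED FROM THIS MODULE (their ED. 10 text VERBATIM, the two refuting data and the script shas are kept in the companion `Lines/F0_P3c_DyRamFourFrame_U3_Laws.md` § «STRUCK (R-22)»): the signed
# κ-Stage-B children (κS-B₀) `stub_U3_kappaSignCount_typeZero` and (κS-B₂) `stub_U3_kappaSignCount_typeTwo_mult` — AS ∀-SENTENCES MODEL-REFUTED ((κS-B₂) at the census cell of record e2b (d,t) = (4,4), e_F = 2, q = 2: REF5 (g22) R5-114 (B),
# ref4 R4-129; (κS-B₀) at (6,8), e_F = 4: R5-109 (3), LH4-r01 (g4) GD∕GD2, LHref-N #343; both data inside Hyp413's ∀ (ref1 R1-630a); HOLD (H1): no payer, ever) — their parent (KSS) `stub_U3_kappaSignModelSum` and (K-SGN-R) `stub_U3_kappaSignLawR`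
# (false as ∀-sentences), and the exact reverse cone `u3_fourFrameLawsWildOfRecordR` (★ №1-R's closed Prop `FourFrameLawsWildOfRecordR` is FALSE; never asserted in ★), `u3_lawsAtR_of_not_isUnit_two`, `u3_kappaSignLawAtR_of_v_two_lt_one` (REF1 (g36) m08 closure = exactly these 7).
# ADDED §K-R2 — the Ω-AWARE RE-LETTER at the SCHEDULE OF RECORD `omegaR : OmegaSchedule` (the ORDER's `ΩR` under an ASCII name; ★ `F0P3cDyRamOmegaRDefs.omegaR`, `omegaR K σ ϖ d a b i = glueSignR σ ϖ d a b i = glueSign σ ϖ d ((b, a, b∕a)_i)`, LH4-p04 (g2) ★ p856975; schedule type ★ №1-R2 p856987, LH4-p10 (g3)):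
# (κS-B₀²) `stub_U3_kappaSignCount2_typeZero`, (κS-B₂²) `stub_U3_kappaSignCount2_typeTwo_mult` (the struck children's sentences with RHS sign `omegaR K σ ϖ d a b i * (…)`; sorried TARGETS), (KSS²) `stub_U3_kappaSignModelSum2` PAID AT BIRTH BY COMPOSITION over
# ★ (iv) `kappaSignModelSum2_of_kappaStageB_complete omegaR` (p856996, LH4-p05 (g4)) from (κ-A₂) + (κS-B₀²) + (κS-B₂²), (K-SGN-R2) `stub_U3_kappaSignLawR2 : … DyadicFence (KappaSignLawAtR2 omegaR depthOfRecord tauOfRecord σ ϖ d t)` PAID AT BIRTH BY COMPOSITION over ★ (iii)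
# `dyadicFence_kappaSignLawAtR2_of_kappaSignModelSum2_8 omegaR` (p856997, LH4-p10 (g3)) from (KSS²), and the binder-free R2 assembly `u3_fourFrameLawsWildOfRecordR2 : FourFrameLawsWildOfRecordR2 omegaR` (+ `_of_kappa Ω`), `u3_lawsAt_of_wildOfRecordR2`, `u3_lawsAtR2_of_not_isUnit_two`,
# `u3_kappaSignLawAtR2_of_v_two_lt_one`, the doubly-scheduled signed edge row `u3_edgeKappaRow_of_kappaSignS2 shift Ω` and its instance of record `u3_edgeKappaRow_ofRecordR2`.  Names + TYPES of every SURVIVING decl unchanged (0 statement bytes); imports: ★ p855598 ↦ ★ p856997, ★ p856605∕p856683 ↦ ★ p856996,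
# + ★ `F0P3cDyRamOmegaRDefs`.  sorries = (the open unsigned κ children of BASE) + {(κS-B₀²), (κS-B₂²)} — again exactly the OPEN rows; `--axioms u3_fourFrameLawsWildOfRecordR2` = trio ∪ `sorryAx`.  COVERED-SET BRIDGE (T18-53 (H2)): on `d % 2 = 1 ∨ 2 * d ≤ t + 2` (every row of record) `omegaR = 1` on every READ axis (else both amplitudes vanish) and
# `KappaSignLawAtR2 omegaR … ↔ KappaSignLawAtR …` (★ p857007 `kappaSignLawAtR2_iff_kappaSignLawAtR_of_forall_eq_one_or_ampl_eq_zero`, discharged at `omegaR` by LH4-p10 (g3)'s `…KappaSignLawR2OfRecord` over LH4-p04 (g2)'s ★ `…GlueSignEval`) — the U4∕tier-0 consumers' one-line specialisation, landed OUTSIDE this module.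
# ED. 12 («(κ-B₂) PAID BY NAME», dealer∕pen∕cutter LH4-plan (g12) WORD #6; heir LEAD F0P3a-plan (g19) T18-55 «U2H∕U3 next editions») = ED. 11 + (κ-B₂) `stub_U3_kappaCount_typeTwo_mult` PAID BY NAME (theorem line over ★ `F0P3cDyRamKappaCountTypeTwoPaid.kappaCount_typeTwo_mult` p856993,
# LH4-p11 (g3): ★ payer p856967 `kappaCount_typeTwo_mult_of_boxSum` (type-2 strata decomposition ★ `finsum_mem_typeTwoPolarisable_eq_sum_box_finsum_mem_stratumTwo` → T₂∕G₁∕G₂∕G₃∕H type-2 κ-sockets ★ p856737 ∕ `…GluedSocketTwoZero` ∕ p856915 ∕ `…CoreHangingTwoSocket` at σ-fixed glue witnesses ★ p856808) over ★ κ-BOX-SUM₂ p856920 ∕ p856939 ∕ p856964);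
# ⇒ (KMS) `stub_U3_kappaModelSum` and (K-ABS-R) `stub_U3_kappaAbsLawR` are now KERNEL-CLOSED (axioms TRIO: (κ-A₂) ⊕ (κ-B₀) ⊕ (κ-B₂) all ★); names + TYPES of every standing decl unchanged (body swap only); sorries = {(κS-B₀), (κS-B₂)} — both MODEL-REFUTED AS TYPED (R-22; HOLD (H1): no payer, ever), STRUCK-PENDING: they leave this module in ED. «κS-RECUT (R-22)» (T18-53).
# ED. 11 (= heir LEAD F0P3a-plan (g19) T18-53 «ED. 11a»; «(κ-B₀) PAID BY NAME», dealer∕pen∕cutter LH4-plan (g12) WORD #1∕#3∕#4) = ED. 10 + (κ-B₀) `stub_U3_kappaCount_typeZero` PAID BY NAME (theorem line over ★ `F0P3cDyRamKappaCountTypeZeroPaid.kappaCount_typeZero` p856938,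
# F0P3a-p01 (g32): ★ payer p856859 `kappaCount_typeZero_of_boxSum` (PART 1 partition → T∕G₁∕G₂∕G₃∕H κ-sockets ★ p856661∕p856706∕p856834∕p856750 at σ-fixed glue witnesses ★ p856808) over ★ κ-BOX-SUM p856864∕p856867∕p856906 (LH4-p14 (g3)));
# names + TYPES of every standing decl unchanged (body swap only); sorries = {(κ-B₂) :498, (κS-B₀), (κS-B₂)} — KMS ∕ K-ABS-R still carry `sorryAx` through (κ-B₂); (κS-B₀)∕(κS-B₂) AS TYPED are MODEL-REFUTED (REF5 R5-109 (6,8) ∕ R5-114 e2b (4,4), ref4 R4-127∕R4-129; heir LEAD T18-50∕T18-53 (R-22), HOLD (H1): no payer, ever) and LEAVE this module in ED. «κS-RECUT (R-22)» (T18-53 Q2 STRIKE; Ω-aware re-letter `…R2`).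
# ED. 10 («κ-SPLIT», dealer LH4-plan (g11) WORD #29 (2); cutter LH4-p05 (g3); (R-21) re-key of the κ-road on the SIGNED class count `kappaCount` (★ DEFS leaf `F0P3cDyRamDiagonalKappaCountDefs` p856497)) = ED. 8 + five NEW registered
# children in §K-R — (κ-A₂) `stub_U3_kappaStageA_typeTwo_mult` (κ-Stage A at type 2 WITH MULTIPLICITY, no one-coset binder; PAID at birth BY NAME: theorem line over ★ `F0P3cDyRamDiagonalKappaOrbitCountMult` p856633), (κ-B₀)
# `stub_U3_kappaCount_typeZero`, (κ-B₂) `stub_U3_kappaCount_typeTwo_mult` (the two κ-Stage-B sums of (KMS) over COMPLETE valued fields with finite residue field — `[CompleteSpace K]` in each child's telescope is load-bearing (REF5 (g22) R5-96–R5-100: a non-complete model has `kappaCount ≡ 0`; dealer WORD #43∕#45, heir LEAD T18-46 (2)): `|Σᶠ kappaCount·stabiliserWeight| = ampl∕4`; sorried — payer road = κB-T (LH4-p04) ⊕ κB-G (LH4-p09 (g3)) ⊕ κB-H ⊕ a Bκ10 assembly),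
# (κS-B₀) `stub_U3_kappaSignCount_typeZero`, (κS-B₂) `stub_U3_kappaSignCount_typeTwo_mult` (the two SIGNED κ-Stage-B sums of (KSS) at the square datum, likewise under `[CompleteSpace K]`; sorried); and the two parents PAID BY COMPOSITION —
# `stub_U3_kappaModelSum := kappaModelSum_of_kappaStageB_complete (κ-A₂) (κ-B₀) (κ-B₂)` (★ ED. 2 p856682 of p856604), `stub_U3_kappaSignModelSum := kappaSignModelSum_of_kappaStageB_complete (κ-A₂) (κS-B₀) (κS-B₂)` (★ ED. 2 p856683 of p856605); names + TYPES of every standing decl unchanged (body swap only);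
# sorries = {(κ-B₀), (κ-B₂), (κS-B₀), (κS-B₂)} — the ONLY `sorry`s left in U3 ((MS-B₂) PAID by LH4-p11 (g2)'s edition below); `stub_U3_kappaAbsLawR` ∕ `stub_U3_kappaSignLawR` unchanged (compositions over the parents).
# ED. 9′ («(MS-B₂) PAID», cutter LH4-p11 (g2); rides on whichever of ED. 8 ∕ ED. 9 «κ-SPLIT» is the BASE — hunks commute) = BASE + (MS-B₂) `stub_U3_stableCount_typeTwo_mult` PAID BY NAME
# (theorem line over ★ `F0P3cDyRamStableCountTypeTwo.finsum_polarisationCount_mul_stabiliserWeight_eq`, LH4-p10 (g2)) ⇒ `stub_U3_stableModelSum` (MS), `stub_U3_stableLaw_RP` (EMIT #7) and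
# `stub_U3_stableLaw_RU` (EMIT #8) are TRIO (sorry-free through ★ NI2 + ★ B10 + ★ (MS-A₂) + ★ (MS-B₂)); remaining sorries {KMS, KSS} (or their κ-SPLIT children);
# ED. 8 («MS-SPLIT», dealer LH4-plan (g11) WORD #29∕#32∕#33; cutter LH4-p11 (g2); LH4-p11 RULING 2026-09-04T00:53Z «RE-KEY tv = 2 ON MULTIPLICITY» on LH4-p09 (g2)'s flag, LH4-p10 (g2) ratified, heir LEAD (R-21)) = ED. 7 + two NEW registered
# children in §S-R — (MS-A₂) `stub_U3_stageA_typeTwo_mult` (Stage A of the type-2 half WITH MULTIPLICITY; PAID at birth BY NAME: theorem line over ★ `F0P3cDyRamDiagonalOrbitCount` ED. 2) and (MS-B₂)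
# `stub_U3_stableCount_typeTwo_mult` (the type-2 stable count with multiplicity `Σᶠ_{𝓛₀(T)} n₂·w = [k]_q`; sorried — payer = ★ `F0P3cDyRamStableCountTypeTwoGeneric` p856349 at `f = n₂·w` once the type-2 sockets land) —
# and `stub_U3_stableModelSum` (MS) PAID BY COMPOSITION `stableModelSum_of_stageB_mult ‹★ B10 type 0› (MS-A₂) (MS-B₂)` (★ `F0P3cDyRamStableModelSumOfStageB` ED. 2; name + TYPE unchanged, body swap only) — s3 {MS-B₂, KMS, KSS};
# ED. 6 ((R-18) «K-ABS-R := NI2 ⊕ KMS», LEAD T18-21; cand F0P3-p01 (g30) 3284ee24b6121cae + this line) = ED. 5 + NEW registered stub `stub_U3_kappaModelSum` (KMS, fenced + datum-guarded, eightfold ω-free) and `stub_U3_kappaAbsLawR` PAID by composition over ★ p855529 `…KappaAbsLawOfKappaModelSum.dyadicFence_kappaAmplitudeLawAtR_of_kappaModelSum8` — s3 {MS, KMS, K-SGN-R};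
# ED. 7 («K-SGN-R := NI2 ⊕ KSS», (R-18) shape; cand F0P3-p01 (g30) d734061b0535fff0 + this line) = ED. 6 + NEW registered stub `stub_U3_kappaSignModelSum` (KSS, fenced + datum-guarded, eightfold ω-free) and `stub_U3_kappaSignLawR` PAID by composition over ★ p855598 `…KappaSignLawOfKappaModelSum.dyadicFence_kappaSignLawAtR_of_kappaSignModelSum8` — s3 {MS, KMS, KSS};
# ED. 5 (dealer pen LH4-plan (g10)) = ED. 4 + (NI2) `stub_U3_normIndexTwo` PAID by ★ p855402 `F0P3cDyRamNormIndexTwo.normIndexTwo` (F0P3-p01 (g30); legs ★ p855352∕p855374 LH4-p09 (g2)) — s3 {MS, K-ABS-R, K-SGN-R};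
# ED. 4 ((R-17) «NI2 ⊕ MS», LEAD T18-15∕16∕17; LH4-p10 (g0) bytes db37013e) = ED. 3 + §S-R (registered stubs `stub_U3_normIndexTwo`, `stub_U3_stableModelSum`; `stub_U3_stableLaw_RP∕_RU` PAID by composition);
# ED. 3 (RC-1, LEAD T18-06 (R-16) ∕ T18-11 (4)) = ED. 2 + §R (re-cut twins over ★ №1-R) + §K-R (the RE-CUT κ-law stubs `stub_U3_kappaAbsLawR∕kappaSignLawR`, sorried, risk line);
# ED. 2 = ED. 1 with `stub_U3_edgeLaw_t2` PAID (★ p854902); ED. 1 = the STABLE law (R-P ∕ R-U), the (U) schedules, the dyadic fence, the (K-1)(c) edge identity, and the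
# sorry-free assembly into ★ №1's closed Props BY NAME — the κ-cuts of record entered ED. 1 as BINDERS (§W); after the e2c∕e3a census (κ-token of record refuted at d < t)
# the κ-law STUBS are stated over the RE-CUT defs of №1-R (§K-R), never over №1's token

Cell `hodgecm-mathlib` (D-0151), FLOOR 0, crux item H413 = `stmt-HodgeConjecture-24833`, route of record `HCCMUnconditional`; Track A; heir LEAD T17-31 (R-8)–(R-11),
T18-00 (d) «U3_Laws stays GATED on TW3 (n2) ∕ D5 (s2) — no K-law stub is written before the (s2) word»; dealer LH4-plan (g10) WORD #15 «REMAINING tier-1: U3_Laws ∕ U4_Rows»,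
WORD #16; desk INVENTORY-TIER1 v1.1 §U3 «n(U3) = 6–7 stubs · files 11–28: `stub_U3_stableLaw_RP ∕ _RU ∕ kappaAbsLaw ∕ kappaSignLaw ∕ N0_closedForm ∕ edgeLaw_t2 ∕
dyadicFence_offDyadic`».  A TIER-1 MODULE (LEAD (R-9)): every PLANNED theorem of the unit as `theorem stub_U3_<name> : ‹statement over ★ DEFS names› := by sorry` + SORRY-FREE
ASSEMBLY concluding BY NAME what the unit feeds upward; sorries ONLY in `stub_*` ((R-10)(e)); NO `def` (definitions live in DEFS leaves); registered BY WRITE only by a writer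
seat (this assembler has `write_cruxes: []`: the dealer writes the bytes); REF1 by-name box + ref4∕REF5∕LHref-N∕LH-ref2 VACUITY PASS before «LANDED n» is said for it ((R-10)(g)).
HONEST LABEL: HC_CM is proved only modulo the 7 printed citations (2 remaining: hLiu418 = stmt-HodgeConjecture-24832, h413 = stmt-HodgeConjecture-24833) until rung 0 closes;
the `stub_*` below that carry `sorry` are TARGETS, nothing is claimed for them; the CENSUS LAWS are EMPIRICAL regularities of record (memo (0b-i) v1.2 86c7f5a26f424de2, 520∕520
values) — PROVER TARGETS, never literature facts; the verdict of record for (D-RAM) stays PRINT [LanglandsShelstad1989 Thm. p. 484 ∕ Rogawski1990 Prop. 4.9.1 (a)] ∕ XL.  Funnel rider (T18-53): the SIGN half of the U3 law of record is RE-LETTERED Ω-aware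
(R-22) after model refutation of (κS-B₀)∕(κS-B₂) AS TYPED (R5-109 (6,8) ∕ R5-114 e2b (4,4)); the struck text is out of the books and out of this module.

WHAT U3 FEEDS UPWARD.  The tier-0 row stubs `stub_rows_unit0 ∕ transvPlus ∕ transvMinus ∕ regular : PieceRowsWild gselStar j` are paid (for the anchor `1_K`, row (1))
through the law socket's §4 joint ★ `F0P3cDyRamAnchorRowsOfFourFrameLaws.anchorRows_of_fourFrameLaws` (#11), whose LAW HYPOTHESES are the three UNFENCED place-wise cuts
`StableLawAt N₀ σ_w ϖ d t_E`, `KappaAmplitudeLawAt N₀ τ σ_w ϖ d t_E`, `KappaSignLawAt N₀ τ σ_w ϖ d t_E` (★ №1 §1) at the CM place datum, next to the wildness binder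
`_h2 : ¬ IsUnit (2 : 𝒪[L_w])` of `PieceRowsWild` (★ №3 :246).  So this module's assembly delivers, AT THE PARAMETERS OF RECORD `(N₀, τ) := (depthOfRecord, tauOfRecord)`
(★ #0a P1∕P2 — the same parameters U2H exports at): (i) the FENCED stable cut at every datum `u3_stableLaw_ofRecord` (from the two parity stubs), its UNFENCED forms
`u3_stableLawAt_of_v_two_lt_one` ∕ `u3_stableLawAt_of_not_isUnit_two` (the `_hS` binder of #11, from `|2| < 1` or from #11's own `¬ IsUnit 2`); (ii) ★ №1's closed Prop
`FourFrameLawsWildOfRecord` BY NAME — `u3_fourFrameLawsWildOfRecord_of_kappa` — and the three binders of #11 at once — `u3_lawsAt_of_kappa_of_not_isUnit_two` ∕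
`u3_lawsAt_of_wildOfRecord` — with the two κ-law cuts as BINDERS in ED. 1 (GATED, §K); (iii) the (K-1)(c) EDGE ROWS for the edge piece `g_E` (layer 2: U2G `stub_U2G_dict_edge`'s
consumers): the stable edge row `u3_edgeStableRow_ofRecord` (from §S + §E) and the signed edge row `u3_edgeKappaRow_of_kappaSign` (from §E + the (K-SGN) cut as a binder).

§S  EXPORT STUBS (sorried): `stub_U3_stableLaw_RP` (d odd — ramified PRIME data, `depthOfRecord d = d`), `stub_U3_stableLaw_RU` (d even — ramified UNIT data, `depthOfRecord d = d + 2`):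
    `DyadicFence (StableLawAt depthOfRecord σ ϖ d t)` at every complete datum with finite residue field.  Desk rows (S) R-P ∕ (S) R-U, LAW-FED, 2–5 files each.
§E  EXPORT STUB (PAID in ED. 2 — theorem line ← ★ p854902): `stub_U3_edgeLaw_t2` — the (K-1)(c) EDGE IDENTITY `e(Γ_b) + 1 = n₀(Γ_b) + n₂(Γ_b)` for every frame element of the law's element datum (the fixed set of a
    near-identity regular elliptic `Γ_b` is a NON-EMPTY FINITE SUBTREE of the wild tree — U0 `wildTree_holds` + ★ p854681 `fixedSet_subtree` — whose vertices have types 0∕2 only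
    (★ `type_eq_zero_or_two_of_isVertexLattice_three`) and whose edges are exactly the fixed flags `N ≤ M` counted by ★ `fixedEdgeCount`; a finite tree has #edges + 1 = #vertices).
    Desk row (K-1) «the t = 2 law row in g_E-currency, transcribed by n₂ = e − n₀ + 1», LAW-FED (linear transcription), 1–2 files; the transcription itself is §A (sorry-free).
§U  PAID IN-MODULE (sorry-free, rfl-grade over ★ #0a P1∕P2): `stub_U3_N0_closedForm` — the schedules of record in closed form by parity (`depthOfRecord d = d ∕ d + 2`,
    `tauOfRecord d = −1 ∕ +1`); the desk's «uniformity statement (U): the laws hold for every 2-adic F_v» is CARRIED BY THE ∀-BINDERS of the §S∕§K statements (every complete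
    `K` with finite residue field, behind the fence) and is deliberately NOT restated as a separate stub (dealer WORD #16 costume rule).
§F  PAID IN-MODULE (sorry-free): `stub_U3_dyadicFence_offDyadic` — off the dyadic places (`¬ |2| < 1`) every fenced law is vacuous; corollary `u3_dyadicFence_of_datum_t_zero` (a datum
    with `t = v_E(2) = 0` is off-dyadic).  Desk row «fence», GLUE, 0–1 files (LH-ref2 (S2′) vacuous-by-design check).
§K  NOT IN ED. 1 — GATED (directive v1.2 D5 (s2); LEAD T18-00 (d)): `stub_U3_kappaAbsLaw : ∀ data, DyadicFence (KappaAmplitudeLawAt depthOfRecord tauOfRecord σ ϖ d t)` and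
    `stub_U3_kappaSignLaw : ∀ data, DyadicFence (KappaSignLawAt depthOfRecord tauOfRecord σ ϖ d t)` (desk rows (K-ABS), (K-SGN); LAW-FED, 2–5 ∕ 2–4 files).  DRAM-TW3 (kit job
    `j347908`; readers LHref-N, LH-ref2, F0P3a-p01) tests the κ-law of record at `e_F = 2` ∕ `q = 4`: an «=» ⇒ ED. 2 adds exactly these two theorems with `:= by sorry` and
    replaces the binders `hKA`∕`hKS` of §W∕§A by their names (a ≤ 20-line delta; every other byte of ED. 1 unchanged); a «≠» ⇒ the (iii) κ-stubs are RE-CUT place-wise with the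
    `e∕q`-dependent token first ((S1) local re-cut) and ED. 2 carries the re-cut statements — which is why ED. 1 binds the κ-cuts instead of naming them.
§W∕§A  ASSEMBLY (sorry-free; axioms = trio ∪ the `sorryAx` of exactly the stubs each line names).

## References (print anchors of the unit; nothing asserted here)
* [Rogawski1990] J. D. Rogawski, *Automorphic Representations of Unitary Groups in Three Variables*, Ann. of Math. Stud. 123 (1990): §4.9 Prop. 4.9.1 (a) p. 55 (orbital
  integrals of near-identity elements as lattice counts), §12.2.
* [Kottwitz1986BaseChangeUnits] R. Kottwitz, *Base change for unit elements of Hecke algebras*, Compositio Math. 60 (1986), §3 (fixed-lattice counting).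
* [Serre1980Trees] J.-P. Serre, *Trees*, Springer (1980): Ch. I §2.2 (a finite tree with `n` vertices has `n − 1` edges), Ch. I §6.1 ∕ Ch. II §1.1 (fixed points; the tree of a rank-one group).
* [Tits1979] J. Tits, *Reductive groups over local fields*, Proc. Sympos. Pure Math. 33.1 (1979), §2.7 p. 48 (the quasi-split ramified `SU(3)`: a tree).
-/

noncomputable section

namespace Summit.HodgeConjecture.HodgeConjecture.Cruxes.H413.F0P3cDyRamFourFrameU3

open scoped Valued WithZero Matrix MatrixGroups
open Finset
open Literature.NumberTheory.Automorphic Literature.NumberTheory.Automorphic.HermitianLattice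
  Literature.NumberTheory.Automorphic.UnitaryLatticeTree Literature.NumberTheory.Automorphic.UnitaryThreeFourFrame
open Summit.HodgeConjecture.HodgeConjecture.Cruxes.H413.F0P3cDyRamFourFrameLawDefs
open Summit.HodgeConjecture.HodgeConjecture.Cruxes.H413.F0P3cDyRamFourFrameLawDefsR
open Summit.HodgeConjecture.HodgeConjecture.Cruxes.H413.F0P3cDyRamFourFrameCensusDefs (fixedEdgeCount)
open Summit.HodgeConjecture.HodgeConjecture.Cruxes.H413.F0P3cDyRamDiagonalTorusDefs (normalisedStableLattices stabiliserWeight IsDualisableLattice)   -- ED. 8∕10: the (MS-A₂)∕(MS-B₂)∕(κ-·) currency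
open Summit.HodgeConjecture.HodgeConjecture.Cruxes.H413.F0P3cDyRamDiagonalStrataDefs (polarisationCount IsTypeTwoPolarisable)                       -- ED. 8: the multiplicity `n₂` (★ StrataDefs ED. 3); ED. 10: `IsTypeTwoPolarisable`
open Summit.HodgeConjecture.HodgeConjecture.Cruxes.H413.F0P3cDyRamDiagonalKappaCountDefs (kappaCount)                             -- ED. 10: the signed κ-count (★ p856497)
open Summit.HodgeConjecture.HodgeConjecture.Cruxes.H413.F0P3cDyRamFourFrameLawDefsR2 (OmegaSchedule KappaSignLawAtS2 KappaSignLawAtR2 FourFrameLawsWildOfRecordR2 fourFrameLawsWildAtR2_of_fenced)   -- ED. 13 «κS-RECUT»: the Ω-aware sign currency (★ №1-R2 p856987)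
open Summit.HodgeConjecture.HodgeConjecture.Cruxes.H413.F0P3cDyRamOmegaRDefs (omegaR)                                                                                                                -- ED. 13: the schedule of record

/-! ## §S-R  (R-17) «NI2 ⊕ MS» — the RE-LINE of the stable law: two frame-free stubs (sorried targets) that pay BOTH §S heads by composition (dealer WORD #38 (2)(3); ★ p855240) -/

/-- **`stub_U3_normIndexTwo`** — (NI2) «LOCAL NORM INDEX TWO, WITH A UNIT WITNESS», at every ramified quadratic datum: there is a `σ`-fixed unit `c` such that every non-zero
`σ`-fixed `x` is a norm `z·σz` or `c` times a norm (`[F^× : N_{E∕F}E^×] ≤ 2` for `F = K^σ`, `c` representing the non-trivial class when the index is `2`).  TRUE for every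
genuine datum (Serre, *Local Fields*, V §3 Prop. 5 + Cor., XIV §3: the unit filtration of a totally ramified quadratic extension; tame leg ★ `RamifiedQuadraticNorm.…` (B-p10),
wild leg over ★ `UnitaryLatticeTreeSelfDualTransitiveWild` §2; at CM completions ★ (J3) `IsCMField.exists_fixed_nonnorm_dichotomy`).  It is the `hNI` binder of ★ p855240 and the
`hdich` binder of ★ p855115 ∕ ★ p855032 §4 (class-only dependence of the diagonal-model count).  Price L (number theory over the ABSTRACT datum); first seat F0P3-p01 (g30)
(dealer WORD #38 (2)), payer file `Theorems/F0P3cDyRamNormIndexTwo.lean`.  A sorried TARGET, not a literature fact. -/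
theorem stub_U3_normIndexTwo :
    ∀ {K : Type} [Field K] [Valued K ℤᵐ⁰] [CompleteSpace K] [Fintype 𝓀[K]] (σ : K →+* K) (ϖ : K) (d t : ℕ),
      IsRamifiedQuadraticDatum σ ϖ d t →
        ∃ c : K, σ c = c ∧ Valued.v c = 1 ∧ ∀ x : K, σ x = x → x ≠ 0 → (∃ z : K, z * σ z = x) ∨ ∃ z : K, z * σ z = c * x :=
  Summit.HodgeConjecture.HodgeConjecture.Cruxes.H413.F0P3cDyRamNormIndexTwo.normIndexTwo  -- PAID ED. 5 (★ p855402; (R-17) NI2 closed 70 min after the ruling)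

/-- **`stub_U3_stageA_typeTwo_mult`** — (MS-A₂) «STAGE A OF THE TYPE-2 HALF, WITH MULTIPLICITY» (ED. 8 child; LH4-p11 (g2) RULING 2026-09-04T00:53Z on LH4-p09 (g2)'s flag that the
type-2 polarisations of a glued lattice with `ρ` even form `q` cosets of `S_F`, LH4-p10 (g2) ratified with the (7,5,5) count 255 = Σ n₂·w ≠ 239 = Σ w): for a `σ`-fixed NON-NORM unit `c` with
the index-two dichotomy, a regular unit diagonal `T = diag(s)` and a uniformiser `ϖ = ↑ϖu` over a finite residue field:
`↑(Σ_{e : Fin 3 → Bool} #{M : M a type-2 vertex lattice of diag(c^{e}), T·M = M}) = 8 · Σᶠ_{M₀ ∈ 𝓛₀(T)} polarisationCount σ ϖ 2 M₀ · stabiliserWeight σ M₀` — the orbit count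
(★ (O1) p855595, ★ (O2a) p855745, ★ (O2b)-MULT p856360∕p856385∕p856421, ★ engine p856016∕p856302) with the POLARISATION COUNT `n₂(M₀) = #(Δ₂(M₀)∕S_F(M₀))` (★ StrataDefs ED. 3
`polarisationCount`) as multiplicity.  The `hA₂` binder of ★ `stableModelSum_of_stageB_mult` VERBATIM.  PAID AT BIRTH BY NAME: theorem line over ★ `F0P3cDyRamDiagonalOrbitCount`
ED. 2 `sum_ncard_fixed_vertices_eq_eight_mul_finsum_polarisationCount_mul_stabiliserWeight` at `tv = 2` (TRIO). -/
theorem stub_U3_stageA_typeTwo_mult :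
    ∀ {K : Type} [Field K] [Valued K ℤᵐ⁰] [Finite 𝓀[K]] {σ : K →+* K}, (∀ x, σ (σ x) = x) → (∀ a, Valued.v (σ a) = Valued.v a) →
      ∀ {ϖ : K}, Valued.v ϖ = WithZero.exp (-1 : ℤ) → ∀ (ϖu : Kˣ), (ϖu : K) = ϖ →
      ∀ {c : K}, σ c = c → Valued.v c = 1 → (¬ ∃ z : K, z * σ z = c) →
      (∀ x : K, σ x = x → x ≠ 0 → (∃ z : K, z * σ z = x) ∨ ∃ z : K, z * σ z = c * x) →
      ∀ {s : Fin 3 → K}, (∀ i, Valued.v (s i) = 1) → (∀ i j, i ≠ j → s i ≠ s j) →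
      ∀ (T : GL (Fin 3) K), (T : Matrix (Fin 3) (Fin 3) K) = Matrix.diagonal s →
        (((∑ e : Fin 3 → Bool, {M : Submodule 𝒪[K] (Fin 3 → K) |
            IsVertexLattice σ ϖ (Matrix.diagonal fun i => if e i then c else (1 : K)) 2 M ∧ mapGL T M = M}.ncard : ℕ) : ℚ)) =
          8 * ∑ᶠ M₀ ∈ normalisedStableLattices T, (polarisationCount σ ϖ 2 M₀ : ℚ) * stabiliserWeight σ M₀ :=
  fun hσ hvσ => fun hϖ ϖu hϖu => fun hσc hcv hc hdich => fun hs hreg T hT =>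
    Summit.HodgeConjecture.HodgeConjecture.Cruxes.H413.F0P3cDyRamDiagonalOrbitCount.sum_ncard_fixed_vertices_eq_eight_mul_finsum_polarisationCount_mul_stabiliserWeight
      hσ hvσ hϖ ϖu hϖu hσc hcv hc hdich hs hreg T hT 2  -- PAID ED. 8 (★ OrbitCount ED. 2; (MS-A₂) closed at birth)

/-- **`stub_U3_stableCount_typeTwo_mult`** — (MS-B₂) «THE TYPE-2 STABLE COUNT WITH MULTIPLICITY» (ED. 8 child; the `hB10₂` binder of ★ `stableModelSum_of_stageB_mult` VERBATIM = LH4-p10 (g2)'s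
B10₂ HEAD v2 2026-09-04T00:58:37Z): behind the dyadic fence, at a ramified quadratic datum and an element datum `(α, β; n₁, n₂, n₃)` with `d ≤ N₀`, `T = diag(α, β, 1)`, `2k + d = n₁ + n₂ + n₃ + 2`:
`Σᶠ_{M ∈ 𝓛₀(T)} polarisationCount σ ϖ 2 M · stabiliserWeight σ M = (q^k − 1)∕(q − 1)` — the multiplicity-weighted count of type-2 polarisable normalised `T`-stable lattices (LH4-p10 MEMO
v2∕v2.2: class by class over the type-2 strata — on-branch `s` odd, glued `r` odd (multiplicity `q` for `ρ` even ≥ 2, LH4-p09 (g2)), core-hanging `r` odd — summed to `[k]_q` by ★ B8).  A sorried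
TARGET — an empirical census law in diagonal-model currency, NOT a literature fact; payer = ★ `F0P3cDyRamStableCountTypeTwoGeneric.finsum_mem_normalisedStableLattices_eq_of_typeTwo_table`
(p856349) at `f := fun M => (polarisationCount σ ϖ 2 M : ℚ) * stabiliserWeight σ M` once the seven type-2 sockets (B4₂ LH4-p13, B56₂ LH4-p08∕F0P3-p01∕§P₂, B7₂ LH4-p07) are ★.
PAID since ED. 9′ BY NAME: theorem line over ★ `F0P3cDyRamStableCountTypeTwo.finsum_polarisationCount_mul_stabiliserWeight_eq` (LH4-p10 (g2); sockets ★ p856520 T · p856576 G1 + p856500 §P₂ · p856639 H ·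
shapes₂ p856358; multiplicity law confirmed at q = 2 (7,5,5) and q = 4 (3,3,3)∕(5,3,3)∕(3,3,5), DRAM-MS2Q4). -/
theorem stub_U3_stableCount_typeTwo_mult :
    ∀ {K : Type} [Field K] [Valued K ℤᵐ⁰] [Fintype 𝓀[K]] {σ : K →+* K} {ϖ : K} {d t : ℕ}, IsRamifiedQuadraticDatum σ ϖ d t →
      Valued.v (2 : K) < 1 → ∀ {α β : K} {N₀ n₁ n₂ n₃ : ℕ}, IsElementDatum σ ϖ N₀ α β n₁ n₂ n₃ → d ≤ N₀ →
      ∀ (T : GL (Fin 3) K), (T : Matrix (Fin 3) (Fin 3) K) = Matrix.diagonal ![α, β, 1] → ∀ (k : ℕ), 2 * k + d = n₁ + n₂ + n₃ + 2 →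
        ∑ᶠ M ∈ normalisedStableLattices T, (polarisationCount σ ϖ 2 M : ℚ) * stabiliserWeight σ M =
          ((Fintype.card 𝓀[K] : ℚ) ^ k - 1) / ((Fintype.card 𝓀[K] : ℚ) - 1) :=
  fun hD h2 => fun hE hN₀ T hT k hk =>
    Summit.HodgeConjecture.HodgeConjecture.Cruxes.H413.F0P3cDyRamStableCountTypeTwo.finsum_polarisationCount_mul_stabiliserWeight_eq hD h2 hE hN₀ T hT k hk
  -- PAID ED. 9′ (★ `F0P3cDyRamStableCountTypeTwo`; (MS-B₂) closed ⇒ (MS) and EMIT #7∕#8 TRIO)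

/-- **`stub_U3_stableModelSum`** — (MS) «THE STABLE LAW IN DIAGONAL-MODEL CURRENCY» (the EIGHT-CLASS MODEL SUM), behind the dyadic fence and the datum, at the threshold of record
`depthOfRecord d` (BOTH parities at once — R-P and R-U differ only through `depthOfRecord`): for every `σ`-fixed unit `c` with the index-two dichotomy, every element datum
`(α, β; n₁, n₂, n₃)` at `depthOfRecord d` (★ #0a E), every `T ∈ GL₃` with matrix `diag(α, β, 1)`, every `k` with `2k + d = n₁ + n₂ + n₃ + 2` and both vertex types `tv ∈ {0, 2}`:
`Σ_{s : Fin 3 → Bool} #{M : M a type-tv vertex lattice of (K³, diag(d_s)), T·M = M} = 8·(q^k − 1)∕(q − 1)` over `ℚ` (`d_s i = c` if `s i` else `1`; `q = #𝓀`) — no four-frame family, no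
`frameElt`, no norm classes: the `hMS` binder of ★ p855240 at `N₀ = depthOfRecord`.  By ★ p855115 (eightfold symmetrisation) this IS the census law (S) of ★ №1 summed over the
eight sign classes `H¹(F, T)`; its finite-ring form is (S-fin) of `F0/P3c/LH4/LH4-p10/g0/MEMO-stableLaw-finite.v1.LH4p10g0.md` — checked EXACTLY by the oracle
`…/explore/finite_engine2.py` on every run (type 0: tame ℚ₃(√3); ℚ₂(√2) (5,3,3)(7,3,3)(7,5,5); e_F = 2: ℚ₂(i)(√(1+i)) (5,5,7)(5,7,5)(5,5,9), ℚ₂(√2)(√√2) (5,5,7); q = 4: ℚ₂(ζ₃)(√2)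
equilateral (3,3,3); type 2: ℚ₂(√2) ×3, ℚ₂(i)(√(1+i)) ×2) and by the 520∕520 census of record.  Price L (the census itself: ROAD A (S-fin) step (3) + the finite count, or ROAD B
the per-frame tree census); first seat LH4-p10 (g0), second LH4-p11 (g0) (dealer WORD #38 (2)).  RISK LINE: empirical law; no cell where it fails is known (e_F ∈ {1,2,3},
q ∈ {2,3,4,5}); a «≠» anywhere re-cuts THIS stub, not the §S heads' bytes.  A sorried TARGET — an empirical census law, NOT a literature fact.  PAID at tier 1 since ED. 8 BY COMPOSITION («MS-SPLIT»): value = ★ `F0P3cDyRamStableModelSumOfStageB.stableModelSum_of_stageB_mult` applied to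
★ `F0P3cDyRamStableCountTypeZero.finsum_stabiliserWeight_dualisable_eq` (type 0, LH4-p10 (g2)), `stub_U3_stageA_typeTwo_mult` (★-paid) and `stub_U3_stableCount_typeTwo_mult` (sorried) — the
(7,5,5) census 8·255 is met WITH multiplicity, not with the indicator (LH4-p09∕p10∕LH4-r01∕REF5, 2026-09-04). -/
theorem stub_U3_stableModelSum :
    ∀ {K : Type} [Field K] [Valued K ℤᵐ⁰] [CompleteSpace K] [Fintype 𝓀[K]] (σ : K →+* K) (ϖ : K) (d t : ℕ),
      DyadicFence (K := K) (IsRamifiedQuadraticDatum σ ϖ d t →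
        ∀ c : K, σ c = c → Valued.v c = 1 → (∀ x : K, σ x = x → x ≠ 0 → (∃ z : K, z * σ z = x) ∨ ∃ z : K, z * σ z = c * x) →
        ∀ (α β : K) (n₁ n₂ n₃ : ℕ), IsElementDatum σ ϖ (depthOfRecord d) α β n₁ n₂ n₃ →
        ∀ (T : GL (Fin 3) K), (T : Matrix (Fin 3) (Fin 3) K) = Matrix.diagonal ![α, β, 1] →
        ∀ (k : ℕ), 2 * k + d = n₁ + n₂ + n₃ + 2 → ∀ tv : ℕ, tv = 0 ∨ tv = 2 →
          ((∑ s : Fin 3 → Bool, {M : Submodule 𝒪[K] (Fin 3 → K) |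
              IsVertexLattice σ ϖ (Matrix.diagonal fun i => if s i then c else (1 : K)) tv M ∧ mapGL T M = M}.ncard : ℕ) : ℚ) =
            8 * ((Fintype.card 𝓀[K] : ℚ) ^ k - 1) / ((Fintype.card 𝓀[K] : ℚ) - 1)) :=
  -- PAID ED. 8 BY COMPOSITION («MS := B10 (type 0) ⊕ (MS-A₂) ⊕ (MS-B₂)», ★ `stableModelSum_of_stageB_mult`; axioms = trio ∪ the `sorryAx` of exactly (MS-B₂))
  Summit.HodgeConjecture.HodgeConjecture.Cruxes.H413.F0P3cDyRamStableModelSumOfStageB.stableModelSum_of_stageB_mult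
    (fun hD h2 => fun hE hN₀ T hT k hk =>
      Summit.HodgeConjecture.HodgeConjecture.Cruxes.H413.F0P3cDyRamStableCountTypeZero.finsum_stabiliserWeight_dualisable_eq hD h2 hE hN₀ T hT k hk)
    stub_U3_stageA_typeTwo_mult stub_U3_stableCount_typeTwo_mult

/-- §S-R · THE FENCED STABLE LAW OF RECORD AT EVERY DATUM FROM (NI2) + (MS) — both parities at once: `DyadicFence (StableLawAt depthOfRecord σ ϖ d t)` by ★ p855240
`stableLawAt_of_normIndexTwo_of_modelSum depthOfRecord` (sorry-free composition; axioms = trio ∪ the `sorryAx` of exactly the two §S-R stubs). -/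
theorem u3_stableLaw_ofRecord_of_NI2_MS {K : Type} [Field K] [Valued K ℤᵐ⁰] [CompleteSpace K] [Fintype 𝓀[K]] (σ : K →+* K) (ϖ : K) (d t : ℕ) :
    DyadicFence (K := K) (StableLawAt depthOfRecord σ ϖ d t) := fun h2 hD =>
  F0P3cDyRamStableLawOfModelSum.stableLawAt_of_normIndexTwo_of_modelSum depthOfRecord σ ϖ d t
    (stub_U3_normIndexTwo σ ϖ d t hD) (stub_U3_stableModelSum σ ϖ d t h2 hD) hD

/-! ## §S  The stable law of record, cut place-wise and by parity of `d` (export stubs — PAID by composition from §S-R since ED. 4) -/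

/-- **`stub_U3_stableLaw_RP`** — THE STABLE LAW (S) AT EVERY RAMIFIED-PRIME DATUM (`d` odd; `depthOfRecord d = d`, §U), behind the dyadic fence `|2| < 1`:
`DyadicFence (StableLawAt depthOfRecord σ ϖ d t)` (★ №1 §1 VERBATIM body: for every four-frame family `f`, element datum `(α, β; n₁, n₂, n₃)` at threshold `depthOfRecord d`,
frames `Γ_b = frameElt σ f b α β`, `2k + d = n₁ + n₂ + n₃ + 2`, and BOTH vertex types `tv ∈ {0, 2}`: `Σ_b n_tv(Γ_b) = 4·(q^k − 1)∕(q − 1)` over `ℚ`).  Desk row «(S) R-P», LAW-FED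
(census of record 520∕520; memo (0b-i) v1.2 86c7f5a26f424de2).  PAID at tier 1 since ED. 4 BY COMPOSITION ((R-17) «NI2 ⊕ MS»): THEOREM LINE under its stub name,
value = §S-R `u3_stableLaw_ofRecord_of_NI2_MS` (★ p855240 ∘ `stub_U3_normIndexTwo` ∘ `stub_U3_stableModelSum`; axioms = trio ∪ the `sorryAx` of exactly those two stubs). -/
theorem stub_U3_stableLaw_RP :
    ∀ {K : Type} [Field K] [Valued K ℤᵐ⁰] [CompleteSpace K] [Fintype 𝓀[K]] (σ : K →+* K) (ϖ : K) (d t : ℕ),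
      d % 2 = 1 → DyadicFence (K := K) (StableLawAt depthOfRecord σ ϖ d t) :=
  fun σ ϖ d t _ => u3_stableLaw_ofRecord_of_NI2_MS σ ϖ d t

/-- **`stub_U3_stableLaw_RU`** — THE STABLE LAW (S) AT EVERY RAMIFIED-UNIT DATUM (`d` even; `depthOfRecord d = d + 2`, §U), behind the dyadic fence:
`DyadicFence (StableLawAt depthOfRecord σ ϖ d t)` (★ №1 §1 VERBATIM body, as in `stub_U3_stableLaw_RP`).  Desk row «(S) R-U», LAW-FED, 2–5 files.  A sorried TARGET — an empirical
census law, NOT a literature fact.  (The tame corner `d = 1, t = 0` never reaches either stub's body: `t = 0` puts `|2| = 1`, off the fence — §F.)  PAID at tier 1 since ED. 4 BY COMPOSITION, as `stub_U3_stableLaw_RP`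
(value = §S-R `u3_stableLaw_ofRecord_of_NI2_MS`). -/
theorem stub_U3_stableLaw_RU :
    ∀ {K : Type} [Field K] [Valued K ℤᵐ⁰] [CompleteSpace K] [Fintype 𝓀[K]] (σ : K →+* K) (ϖ : K) (d t : ℕ),
      d % 2 = 0 → DyadicFence (K := K) (StableLawAt depthOfRecord σ ϖ d t) :=
  fun σ ϖ d t _ => u3_stableLaw_ofRecord_of_NI2_MS σ ϖ d t

/-! ## §E  The (K-1)(c) edge identity (export stub — PAID, theorem line since ED. 2) -/

/-- **`stub_U3_edgeLaw_t2`** — THE (K-1)(c) EDGE IDENTITY behind the fence: for every datum, four-frame family, element datum `(α, β; n)` at threshold `depthOfRecord d` and frames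
`Γ_b = frameElt σ f b α β`:  `fixedEdgeCount σ ϖ (Γ_b) + 1 = n₀(Γ_b) + n₂(Γ_b)` for every `b` — the number of FIXED EDGES (flags `N ≤ M`, type 2 below type 0, both fixed; ★ U2G
`fixedEdgeCount`) is one less than the number of fixed vertices (types 0 and 2 are the only types, ★ `type_eq_zero_or_two_of_isVertexLattice_three`), because the fixed set of the
near-identity regular elliptic `Γ_b` is a NON-EMPTY FINITE SUBTREE of the wild tree (U0 `wildTree_holds`, ★ p854681 `fixedSet_subtree_of_isRamifiedQuadraticDatum`; non-empty:
`Γ_b` lies in the compact torus of the frame; finite: `Γ_b` is regular elliptic) and a finite tree has one more vertex than edges [Serre1980Trees, I §2.2].  Desk row «(K-1) edgeLaw_t2»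
(«n₂ = e − n₀ + 1»), LAW-FED (linear transcription), 1–2 files; the transcribed ROWS are §A `u3_edgeStableRow_ofRecord` ∕ `u3_edgeKappaRow_of_kappaSign` (sorry-free).  PAID at tier 2 by
★ p854902 `F0P3cDyRamU3EdgeLawT2.edgeLaw_t2` (LH4-p09 (g0): `Γ_b ∈ U(σ, Φ₃)`, the FENCED wild tree ★ `wildTree_of_wildTransitivity wildTransitivity_holds`, the fixed set finite
(unimodular diagonal model + ★ J4a) and non-empty (`A·𝒪³`), ★ `RootedTree.ncard_fixedPoints_eq_ncard_fixedEdges_add_one`, two dictionaries); THEOREM LINE under its stub name. -/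
theorem stub_U3_edgeLaw_t2 :
    ∀ {K : Type} [Field K] [Valued K ℤᵐ⁰] [CompleteSpace K] [Fintype 𝓀[K]] (σ : K →+* K) (ϖ : K) (d t : ℕ),
      DyadicFence (K := K)
        (IsRamifiedQuadraticDatum σ ϖ d t →
          ∀ (f : Fin 4 → Fin 3 → (Fin 3 → K)), IsFourFrameFamily σ f →
          ∀ (α β : K) (n₁ n₂ n₃ : ℕ), IsElementDatum σ ϖ (depthOfRecord d) α β n₁ n₂ n₃ →
          ∀ (Γ : Fin 4 → GL (Fin 3) K), (∀ b, (Γ b : Matrix (Fin 3) (Fin 3) K) = frameElt σ f b α β) →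
          ∀ b : Fin 4, fixedEdgeCount σ ϖ (Γ b) + 1 = fixedVertexCount σ ϖ 0 (Γ b) + fixedVertexCount σ ϖ 2 (Γ b)) :=
  F0P3cDyRamU3EdgeLawT2.edgeLaw_t2

/-! ## §U  The schedules of record in closed form (desk row `N0_closedForm`) — PAID in-module, rfl-grade over ★ #0a P1∕P2 -/

/-- **`stub_U3_N0_closedForm`** (PAID, sorry-free) — THE PARAMETERS OF RECORD IN CLOSED FORM BY PARITY: at ramified-PRIME data (`d` odd) `depthOfRecord d = d` and `tauOfRecord d = −1`;
at ramified-UNIT data (`d` even) `depthOfRecord d = d + 2` and `tauOfRecord d = +1` (★ #0a P1 `if d % 2 = 1 then d else d + 2`, P2 `if d % 2 = 1 then −1 else 1`).  The desk's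
uniformity clause (U) «the laws hold for every 2-adic `F_v` (`q = 2^f`, `e_F ≥ 1`, `d ≤ 2e_F + 1`)» is the ∀-binder block of the §S∕§K statements themselves and is not restated. -/
theorem stub_U3_N0_closedForm (d : ℕ) :
    (d % 2 = 1 → depthOfRecord d = d ∧ tauOfRecord d = -1) ∧ (d % 2 = 0 → depthOfRecord d = d + 2 ∧ tauOfRecord d = 1) := by
  refine ⟨fun h => ?_, fun h => ?_⟩
  · simp [depthOfRecord, tauOfRecord, h]
  · simp [depthOfRecord, tauOfRecord, h]

/-- §U · `depthOfRecord d = d` at ramified-PRIME data (`d` odd). -/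
theorem u3_depthOfRecord_of_odd {d : ℕ} (h : d % 2 = 1) : depthOfRecord d = d := ((stub_U3_N0_closedForm d).1 h).1

/-- §U · `depthOfRecord d = d + 2` at ramified-UNIT data (`d` even). -/
theorem u3_depthOfRecord_of_even {d : ℕ} (h : d % 2 = 0) : depthOfRecord d = d + 2 := ((stub_U3_N0_closedForm d).2 h).1

/-- §U · `tauOfRecord d = −1` at ramified-PRIME data (`d` odd). -/
theorem u3_tauOfRecord_of_odd {d : ℕ} (h : d % 2 = 1) : tauOfRecord d = -1 := ((stub_U3_N0_closedForm d).1 h).2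

/-- §U · `tauOfRecord d = +1` at ramified-UNIT data (`d` even). -/
theorem u3_tauOfRecord_of_even {d : ℕ} (h : d % 2 = 0) : tauOfRecord d = 1 := ((stub_U3_N0_closedForm d).2 h).2

/-! ## §F  The dyadic fence off the dyadic places (desk row `dyadicFence_offDyadic`) — PAID in-module -/

/-- **`stub_U3_dyadicFence_offDyadic`** (PAID, sorry-free) — OFF THE DYADIC PLACES EVERY FENCED LAW IS VACUOUS: `¬ |2| < 1 → DyadicFence P` for any `P` (the laws are only
CLAIMED at `|2| < 1`, ★ №1 (S2); the odd-`p` ramified places are (D-UNR)∕tame ★ and never ask a four-frame law).  LH-ref2 (S2′) vacuous-by-design check. -/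
theorem stub_U3_dyadicFence_offDyadic {K : Type} [Field K] [Valued K ℤᵐ⁰] {P : Prop} (h : ¬ Valued.v (2 : K) < 1) : DyadicFence (K := K) P :=
  fun h2 => absurd h2 h

/-- §F · a datum with `t = v_E(2) = 0` (the tame ∕ off-`2` corner of ★ #0a D: `|2| = |ϖ|^0 = 1`) is off the fence: every fenced law is vacuous there. -/
theorem u3_dyadicFence_of_datum_t_zero {K : Type} [Field K] [Valued K ℤᵐ⁰] {σ : K →+* K} {ϖ : K} {d : ℕ} {P : Prop}
    (hD : IsRamifiedQuadraticDatum σ ϖ d 0) : DyadicFence (K := K) P := by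
  refine stub_U3_dyadicFence_offDyadic (K := K) ?_
  have h2 : Valued.v (2 : K) = 1 := by simpa using hD.2.2.2.2.2.2
  simp [h2]

/-- §F · the wildness binder of the tier-0 rows (`¬ IsUnit (2 : 𝒪[K])`, ★ №3 `PieceRowsWild` :246 ∕ ★ #11) opens the fence: `|2| < 1`. -/
theorem u3_v_two_lt_one_of_not_isUnit_two {K : Type} [Field K] [Valued K ℤᵐ⁰] (h2 : ¬ IsUnit (2 : 𝒪[K])) : Valued.v (2 : K) < 1 := by
  by_contra h
  apply h2
  have hc : ((2 : 𝒪[K]) : K) = 2 := by norm_cast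
  have hle : Valued.v ((2 : 𝒪[K]) : K) ≤ 1 := (2 : 𝒪[K]).2
  have h1 : Valued.v ((2 : 𝒪[K]) : K) = 1 := le_antisymm hle (by rw [hc]; exact not_lt.mp h)
  have hu : IsUnit ((2 : 𝒪[K]) : K) := by
    rw [isUnit_iff_ne_zero]
    intro h0
    rw [h0, map_zero] at h1
    exact zero_ne_one h1
  exact Valuation.Integers.isUnit_of_one (Valuation.integer.integers (Valued.v : Valuation K ℤᵐ⁰)) hu h1

/-! ## §W  Assembly, part 1 (sorry-free): the stable cut at every datum; ★ №1's closed Prop `FourFrameLawsWildOfRecord` and the three law binders of ★ #11, modulo the GATED κ-cuts -/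

/-- **§W · THE FENCED STABLE LAW OF RECORD AT EVERY DATUM** — by parity of `d` from `stub_U3_stableLaw_RP` ∕ `stub_U3_stableLaw_RU`.  Sorry-free composition. -/
theorem u3_stableLaw_ofRecord {K : Type} [Field K] [Valued K ℤᵐ⁰] [CompleteSpace K] [Fintype 𝓀[K]] (σ : K →+* K) (ϖ : K) (d t : ℕ) :
    DyadicFence (K := K) (StableLawAt depthOfRecord σ ϖ d t) := by
  rcases Nat.mod_two_eq_zero_or_one d with h | h
  · exact stub_U3_stableLaw_RU σ ϖ d t h
  · exact stub_U3_stableLaw_RP σ ϖ d t h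

/-- §W · the UNFENCED stable cut at a dyadic datum (`|2| < 1`) — the `_hS` binder of ★ #11 `anchorRows_of_fourFrameLaws` at `N₀ := depthOfRecord`. -/
theorem u3_stableLawAt_of_v_two_lt_one {K : Type} [Field K] [Valued K ℤᵐ⁰] [CompleteSpace K] [Fintype 𝓀[K]] (σ : K →+* K) (ϖ : K) (d t : ℕ)
    (h2 : Valued.v (2 : K) < 1) : StableLawAt depthOfRecord σ ϖ d t :=
  u3_stableLaw_ofRecord σ ϖ d t h2

/-- §W · the UNFENCED stable cut from the tier-0 wildness binder `¬ IsUnit (2 : 𝒪[K])` (★ №3 `PieceRowsWild` :246 ∕ ★ #11 `_h2`). -/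
theorem u3_stableLawAt_of_not_isUnit_two {K : Type} [Field K] [Valued K ℤᵐ⁰] [CompleteSpace K] [Fintype 𝓀[K]] (σ : K →+* K) (ϖ : K) (d t : ℕ)
    (h2 : ¬ IsUnit (2 : 𝒪[K])) : StableLawAt depthOfRecord σ ϖ d t :=
  u3_stableLaw_ofRecord σ ϖ d t (u3_v_two_lt_one_of_not_isUnit_two h2)

/-- **§W · ★ №1's CLOSED PROP `FourFrameLawsWildOfRecord` BY NAME, modulo the GATED κ-cuts** — from the §S stubs (through `u3_stableLaw_ofRecord`) and the two κ-law cuts of record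
as BINDERS `hKA` (K-ABS) ∕ `hKS` (K-SGN) (ED. 2 after the (s2) word: the binders become `stub_U3_kappaAbsLaw` ∕ `stub_U3_kappaSignLaw` and this theorem loses them).  Sorry-free. -/
theorem u3_fourFrameLawsWildOfRecord_of_kappa
    (hKA : ∀ {K : Type} [Field K] [Valued K ℤᵐ⁰] [CompleteSpace K] [Fintype 𝓀[K]] (σ : K →+* K) (ϖ : K) (d t : ℕ),
      DyadicFence (K := K) (KappaAmplitudeLawAt depthOfRecord tauOfRecord σ ϖ d t))
    (hKS : ∀ {K : Type} [Field K] [Valued K ℤᵐ⁰] [CompleteSpace K] [Fintype 𝓀[K]] (σ : K →+* K) (ϖ : K) (d t : ℕ),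
      DyadicFence (K := K) (KappaSignLawAt depthOfRecord tauOfRecord σ ϖ d t)) :
    FourFrameLawsWildOfRecord := by
  intro K _ _ _ _ σ ϖ d t h2
  exact ⟨u3_stableLaw_ofRecord σ ϖ d t h2, hKA σ ϖ d t h2, hKS σ ϖ d t h2⟩

/-- **§W · THE THREE LAW BINDERS OF ★ #11 AT ONCE**, at the parameters of record, at a datum with `¬ IsUnit (2 : 𝒪[K])` — from ★ №1's closed Prop `FourFrameLawsWildOfRecord`
(however obtained: `u3_fourFrameLawsWildOfRecord_of_kappa` in ED. 1, binder-free in ED. 2).  This is the one-name hand-off to the payer of tier-0 `stub_rows_unit0`. -/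
theorem u3_lawsAt_of_wildOfRecord (h : FourFrameLawsWildOfRecord) {K : Type} [Field K] [Valued K ℤᵐ⁰] [CompleteSpace K] [Fintype 𝓀[K]]
    (σ : K →+* K) (ϖ : K) (d t : ℕ) (h2 : ¬ IsUnit (2 : 𝒪[K])) :
    StableLawAt depthOfRecord σ ϖ d t ∧ KappaAmplitudeLawAt depthOfRecord tauOfRecord σ ϖ d t ∧ KappaSignLawAt depthOfRecord tauOfRecord σ ϖ d t :=
  h σ ϖ d t (u3_v_two_lt_one_of_not_isUnit_two h2)

/-- §W · the three law binders of ★ #11 at a datum with `¬ IsUnit (2 : 𝒪[K])`, straight from the §S stubs and the GATED κ-cuts as binders (ED. 1 form). -/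
theorem u3_lawsAt_of_kappa_of_not_isUnit_two
    (hKA : ∀ {K : Type} [Field K] [Valued K ℤᵐ⁰] [CompleteSpace K] [Fintype 𝓀[K]] (σ : K →+* K) (ϖ : K) (d t : ℕ),
      DyadicFence (K := K) (KappaAmplitudeLawAt depthOfRecord tauOfRecord σ ϖ d t))
    (hKS : ∀ {K : Type} [Field K] [Valued K ℤᵐ⁰] [CompleteSpace K] [Fintype 𝓀[K]] (σ : K →+* K) (ϖ : K) (d t : ℕ),
      DyadicFence (K := K) (KappaSignLawAt depthOfRecord tauOfRecord σ ϖ d t))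
    {K : Type} [Field K] [Valued K ℤᵐ⁰] [CompleteSpace K] [Fintype 𝓀[K]] (σ : K →+* K) (ϖ : K) (d t : ℕ) (h2 : ¬ IsUnit (2 : 𝒪[K])) :
    StableLawAt depthOfRecord σ ϖ d t ∧ KappaAmplitudeLawAt depthOfRecord tauOfRecord σ ϖ d t ∧ KappaSignLawAt depthOfRecord tauOfRecord σ ϖ d t :=
  u3_lawsAt_of_wildOfRecord (u3_fourFrameLawsWildOfRecord_of_kappa hKA hKS) σ ϖ d t h2

/-! ## §A  Assembly, part 2 (sorry-free): the (K-1)(c) edge rows — the `t = 2` law transcribed into `g_E`-currency by `n₂ = e − n₀ + 1` -/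

/-- §A · the κ-weights of each slot sum to zero over the four frames (the three NON-TRIVIAL characters of `(ℤ∕2)²`; ★ #0a H4∕H5 by computation). -/
theorem u3_sum_kappaChar_eq_zero (i : Fin 3) : ∑ b : Fin 4, kappaChar i b = 0 := by
  fin_cases i <;> simp [kappaChar, signPair, Fin.sum_univ_four]

/-- **§A · THE STABLE EDGE ROW OF RECORD** — behind the fence, for the law's element datum at threshold `depthOfRecord d` and `2k + d = n₁ + n₂ + n₃ + 2`:
`Σ_b e(Γ_b) = 2·(4(q^k − 1)∕(q − 1)) − 4` over `ℚ` — the stable law (S) at BOTH vertex types (§S, through `u3_stableLaw_ofRecord`) transcribed by the edge identity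
`stub_U3_edgeLaw_t2` (`e = n₀ + n₂ − 1` frame by frame).  The `g_E` stable row of desk (K-1)(c).  Sorry-free modulo the three named stubs. -/
theorem u3_edgeStableRow_ofRecord {K : Type} [Field K] [Valued K ℤᵐ⁰] [CompleteSpace K] [Fintype 𝓀[K]] (σ : K →+* K) (ϖ : K) (d t : ℕ)
    (h2 : Valued.v (2 : K) < 1) (hD : IsRamifiedQuadraticDatum σ ϖ d t)
    (f : Fin 4 → Fin 3 → (Fin 3 → K)) (hf : IsFourFrameFamily σ f)
    (α β : K) (n₁ n₂ n₃ : ℕ) (hE : IsElementDatum σ ϖ (depthOfRecord d) α β n₁ n₂ n₃)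
    (Γ : Fin 4 → GL (Fin 3) K) (hΓ : ∀ b, (Γ b : Matrix (Fin 3) (Fin 3) K) = frameElt σ f b α β)
    (k : ℕ) (hk : 2 * k + d = n₁ + n₂ + n₃ + 2) :
    ((∑ b : Fin 4, fixedEdgeCount σ ϖ (Γ b) : ℕ) : ℚ) =
      2 * (4 * ((Fintype.card 𝓀[K] : ℚ) ^ k - 1) / ((Fintype.card 𝓀[K] : ℚ) - 1)) - 4 := by
  have hS := u3_stableLaw_ofRecord σ ϖ d t h2 hD f hf α β n₁ n₂ n₃ hE Γ hΓ k hk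
  have h0 := hS 0 (Or.inl rfl)
  have h2' := hS 2 (Or.inr rfl)
  have hid := stub_U3_edgeLaw_t2 σ ϖ d t h2 hD f hf α β n₁ n₂ n₃ hE Γ hΓ
  have hb : ∀ b : Fin 4, (fixedEdgeCount σ ϖ (Γ b) : ℚ) = fixedVertexCount σ ϖ 0 (Γ b) + fixedVertexCount σ ϖ 2 (Γ b) - 1 := by
    intro b
    have := congrArg (fun n : ℕ => (n : ℚ)) (hid b)
    push_cast at this
    linarith
  push_cast at h0 h2' ⊢
  simp_rw [hb, Finset.sum_sub_distrib, Finset.sum_add_distrib, h0, h2']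
  simp only [Finset.sum_const, Finset.card_univ, Fintype.card_fin]
  ring

/-- **§A · THE SIGNED EDGE ROW** — behind the fence, on the SQUARE family of (K-SGN) (canonical roots `a, b`, skew `δ`, element datum at `depthOfRecord d`, `2k + d = Σn + 2`,
slot `i`, parity datum `B`): `Σ_b κ_i(b)·e(Γ_b) = κ_i(b₀)·ω(Π x)·(ampl q k B + ampl q k (B + τ d))` — the κ-SIGN law at BOTH vertex types transcribed by `stub_U3_edgeLaw_t2` and
`Σ_b κ_i(b) = 0`.  The (K-SGN) cut enters as the BINDER `hKS` (GATED, §K; ED. 2: `stub_U3_kappaSignLaw σ ϖ d t h2`).  The `g_E` κ-row of desk (K-1)(c).  Sorry-free. -/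
theorem u3_edgeKappaRow_of_kappaSign {K : Type} [Field K] [Valued K ℤᵐ⁰] [CompleteSpace K] [Fintype 𝓀[K]] (σ : K →+* K) (ϖ : K) (d t : ℕ)
    (hKS : KappaSignLawAt depthOfRecord tauOfRecord σ ϖ d t)
    (h2 : Valued.v (2 : K) < 1) (hD : IsRamifiedQuadraticDatum σ ϖ d t)
    (f : Fin 4 → Fin 3 → (Fin 3 → K)) (hf : IsFourFrameFamily σ f)
    (δ : K) (hδ : σ δ = -δ) (hδ0 : δ ≠ 0)
    (a b : K) (ha : a * σ a = 1) (hb : b * σ b = 1) (ha2 : Valued.v (a - 1) < Valued.v (2 : K)) (hb2 : Valued.v (b - 1) < Valued.v (2 : K))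
    (n₁ n₂ n₃ : ℕ) (hE : IsElementDatum σ ϖ (depthOfRecord d) (a * a) (b * b) n₁ n₂ n₃)
    (Γ : Fin 4 → GL (Fin 3) K) (hΓ : ∀ b', (Γ b' : Matrix (Fin 3) (Fin 3) K) = frameElt σ f b' (a * a) (b * b))
    (k : ℕ) (hk : 2 * k + d = n₁ + n₂ + n₃ + 2)
    (i : Fin 3) (B : ℤ) (hB : 2 * B = ((![n₁, n₂, n₃] : Fin 3 → ℕ) i : ℤ) - d + 2 - 2 * t) :
    ((∑ b' : Fin 4, kappaChar i b' * (fixedEdgeCount σ ϖ (Γ b') : ℤ) : ℤ) : ℚ) =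
      (baseSign σ i * normSign σ (fPartProd δ ![a, b, 1] i) : ℤ) *
        (ampl (Fintype.card 𝓀[K]) k B + ampl (Fintype.card 𝓀[K]) k (B + tauOfRecord d)) := by
  obtain ⟨h0, h2'⟩ := hKS hD f hf δ hδ hδ0 a b ha hb ha2 hb2 n₁ n₂ n₃ hE Γ hΓ k hk i B hB
  have hid := stub_U3_edgeLaw_t2 σ ϖ d t h2 hD f hf (a * a) (b * b) n₁ n₂ n₃ hE Γ hΓ
  have hb' : ∀ b' : Fin 4, (fixedEdgeCount σ ϖ (Γ b') : ℤ) = fixedVertexCount σ ϖ 0 (Γ b') + fixedVertexCount σ ϖ 2 (Γ b') - 1 := by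
    intro b'
    have := congrArg (fun n : ℕ => (n : ℤ)) (hid b')
    push_cast at this
    linarith
  have hsum : (∑ b' : Fin 4, kappaChar i b' * (fixedEdgeCount σ ϖ (Γ b') : ℤ) : ℤ) =
      (∑ b' : Fin 4, kappaChar i b' * (fixedVertexCount σ ϖ 0 (Γ b') : ℤ)) +
        (∑ b' : Fin 4, kappaChar i b' * (fixedVertexCount σ ϖ 2 (Γ b') : ℤ)) - ∑ b' : Fin 4, kappaChar i b' := by
    simp_rw [hb', ← Finset.sum_add_distrib, ← Finset.sum_sub_distrib]
    exact Finset.sum_congr rfl fun _ _ => by ring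
  rw [hsum, u3_sum_kappaChar_eq_zero, sub_zero]
  push_cast at h0 h2' ⊢
  rw [h0, h2']
  ring


/-! ## §R  (ED. 3, RC-1 — LEAD T18-06 (R-16) ∕ T18-11 (4)) the re-cut twins of §W∕§A over DEFS LEAF №1-R: schedule-general (`…S shift`) and at the re-cut schedule (`…R`) -/

/-- **§R · ★ №1-R's CLOSED PROP `FourFrameLawsWildOfRecordR` BY NAME, modulo the re-cut κ-cuts as BINDERS** (the RC-1 twin of `u3_fourFrameLawsWildOfRecord_of_kappa`; when §K-R
is paid the binders are `stub_U3_kappaAbsLawR` ∕ `stub_U3_kappaSignLawR`).  Sorry-free modulo the two §S stubs. -/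
theorem u3_fourFrameLawsWildOfRecordR_of_kappa
    (hKA : ∀ {K : Type} [Field K] [Valued K ℤᵐ⁰] [CompleteSpace K] [Fintype 𝓀[K]] (σ : K →+* K) (ϖ : K) (d t : ℕ),
      DyadicFence (K := K) (KappaAmplitudeLawAtR depthOfRecord tauOfRecord σ ϖ d t))
    (hKS : ∀ {K : Type} [Field K] [Valued K ℤᵐ⁰] [CompleteSpace K] [Fintype 𝓀[K]] (σ : K →+* K) (ϖ : K) (d t : ℕ),
      DyadicFence (K := K) (KappaSignLawAtR depthOfRecord tauOfRecord σ ϖ d t)) :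
    FourFrameLawsWildOfRecordR := by
  intro K _ _ _ _ σ ϖ d t h2
  exact ⟨u3_stableLaw_ofRecord σ ϖ d t h2, hKA σ ϖ d t h2, hKS σ ϖ d t h2⟩

/-- **§R · THE THREE RE-CUT LAW BINDERS OF #11S (`anchorRows_of_fourFrameLawsS shiftR`) AT ONCE**, at the parameters of record, at a datum with `¬ IsUnit (2 : 𝒪[K])`, from ★ №1-R's
closed Prop `FourFrameLawsWildOfRecordR` — the one-name hand-off to the payer of tier-0 `stub_rows_unit0` after RC-1.  TRIO. -/
theorem u3_lawsAt_of_wildOfRecordR (h : FourFrameLawsWildOfRecordR) {K : Type} [Field K] [Valued K ℤᵐ⁰] [CompleteSpace K] [Fintype 𝓀[K]]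
    (σ : K →+* K) (ϖ : K) (d t : ℕ) (h2 : ¬ IsUnit (2 : 𝒪[K])) :
    StableLawAt depthOfRecord σ ϖ d t ∧ KappaAmplitudeLawAtR depthOfRecord tauOfRecord σ ϖ d t ∧ KappaSignLawAtR depthOfRecord tauOfRecord σ ϖ d t :=
  h σ ϖ d t (u3_v_two_lt_one_of_not_isUnit_two h2)

/-- §R · the same from the §S stubs and the re-cut κ-cuts as binders (ED. 2-draft form). -/
theorem u3_lawsAt_of_kappaR_of_not_isUnit_two
    (hKA : ∀ {K : Type} [Field K] [Valued K ℤᵐ⁰] [CompleteSpace K] [Fintype 𝓀[K]] (σ : K →+* K) (ϖ : K) (d t : ℕ),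
      DyadicFence (K := K) (KappaAmplitudeLawAtR depthOfRecord tauOfRecord σ ϖ d t))
    (hKS : ∀ {K : Type} [Field K] [Valued K ℤᵐ⁰] [CompleteSpace K] [Fintype 𝓀[K]] (σ : K →+* K) (ϖ : K) (d t : ℕ),
      DyadicFence (K := K) (KappaSignLawAtR depthOfRecord tauOfRecord σ ϖ d t))
    {K : Type} [Field K] [Valued K ℤᵐ⁰] [CompleteSpace K] [Fintype 𝓀[K]] (σ : K →+* K) (ϖ : K) (d t : ℕ) (h2 : ¬ IsUnit (2 : 𝒪[K])) :
    StableLawAt depthOfRecord σ ϖ d t ∧ KappaAmplitudeLawAtR depthOfRecord tauOfRecord σ ϖ d t ∧ KappaSignLawAtR depthOfRecord tauOfRecord σ ϖ d t :=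
  u3_lawsAt_of_wildOfRecordR (u3_fourFrameLawsWildOfRecordR_of_kappa hKA hKS) σ ϖ d t h2

/-- **§R · THE SIGNED EDGE ROW, SCHEDULE-GENERAL** (RC-1 twin of `u3_edgeKappaRow_of_kappaSign`): for ANY depth-shift schedule `shift`, the (K-SGN-S) cut `KappaSignLawAtS shift …`
(binder `hKS`) and the edge identity `stub_U3_edgeLaw_t2` give `Σ_b κ_i(b)·e(Γ_b) = sign·(ampl k B + ampl k (B + τ d))` for the parity datum `2B = n_i − d + 2 − 2·shift d t`
(`shift := shiftT` is the ED. 1 theorem, `shift := shiftR` the re-cut).  Sorry-free modulo `stub_U3_edgeLaw_t2`. -/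
theorem u3_edgeKappaRow_of_kappaSignS (shift : ℕ → ℕ → ℤ) {K : Type} [Field K] [Valued K ℤᵐ⁰] [CompleteSpace K] [Fintype 𝓀[K]] (σ : K →+* K) (ϖ : K) (d t : ℕ)
    (hKS : KappaSignLawAtS shift depthOfRecord tauOfRecord σ ϖ d t)
    (h2 : Valued.v (2 : K) < 1) (hD : IsRamifiedQuadraticDatum σ ϖ d t)
    (f : Fin 4 → Fin 3 → (Fin 3 → K)) (hf : IsFourFrameFamily σ f)
    (δ : K) (hδ : σ δ = -δ) (hδ0 : δ ≠ 0)
    (a b : K) (ha : a * σ a = 1) (hb : b * σ b = 1) (ha2 : Valued.v (a - 1) < Valued.v (2 : K)) (hb2 : Valued.v (b - 1) < Valued.v (2 : K))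
    (n₁ n₂ n₃ : ℕ) (hE : IsElementDatum σ ϖ (depthOfRecord d) (a * a) (b * b) n₁ n₂ n₃)
    (Γ : Fin 4 → GL (Fin 3) K) (hΓ : ∀ b', (Γ b' : Matrix (Fin 3) (Fin 3) K) = frameElt σ f b' (a * a) (b * b))
    (k : ℕ) (hk : 2 * k + d = n₁ + n₂ + n₃ + 2)
    (i : Fin 3) (B : ℤ) (hB : 2 * B = ((![n₁, n₂, n₃] : Fin 3 → ℕ) i : ℤ) - d + 2 - 2 * shift d t) :
    ((∑ b' : Fin 4, kappaChar i b' * (fixedEdgeCount σ ϖ (Γ b') : ℤ) : ℤ) : ℚ) =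
      (baseSign σ i * normSign σ (fPartProd δ ![a, b, 1] i) : ℤ) *
        (ampl (Fintype.card 𝓀[K]) k B + ampl (Fintype.card 𝓀[K]) k (B + tauOfRecord d)) := by
  obtain ⟨h0, h2'⟩ := hKS hD f hf δ hδ hδ0 a b ha hb ha2 hb2 n₁ n₂ n₃ hE Γ hΓ k hk i B hB
  have hid := stub_U3_edgeLaw_t2 σ ϖ d t h2 hD f hf (a * a) (b * b) n₁ n₂ n₃ hE Γ hΓ
  have hb' : ∀ b' : Fin 4, (fixedEdgeCount σ ϖ (Γ b') : ℤ) = fixedVertexCount σ ϖ 0 (Γ b') + fixedVertexCount σ ϖ 2 (Γ b') - 1 := by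
    intro b'
    have := congrArg (fun n : ℕ => (n : ℤ)) (hid b')
    push_cast at this
    linarith
  have hsum : (∑ b' : Fin 4, kappaChar i b' * (fixedEdgeCount σ ϖ (Γ b') : ℤ) : ℤ) =
      (∑ b' : Fin 4, kappaChar i b' * (fixedVertexCount σ ϖ 0 (Γ b') : ℤ)) +
        (∑ b' : Fin 4, kappaChar i b' * (fixedVertexCount σ ϖ 2 (Γ b') : ℤ)) - ∑ b' : Fin 4, kappaChar i b' := by
    simp_rw [hb', ← Finset.sum_add_distrib, ← Finset.sum_sub_distrib]
    exact Finset.sum_congr rfl fun _ _ => by ring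
  rw [hsum, u3_sum_kappaChar_eq_zero, sub_zero]
  push_cast at h0 h2' ⊢
  rw [h0, h2']
  ring

/-! ## §K-R  (ED. 3 — κ-GATE (3)(b)(ii) CLOSED FOR WRITING by LEAD T18-11 (4); payer heads HOME-only until TW4) the RE-CUT κ-laws of record, cut place-wise (sorried export stubs), and the binder-free assembly -/

/-- **(κ-A₂) `stub_U3_kappaStageA_typeTwo_mult`** — κ-STAGE A AT TYPE 2 WITH MULTIPLICITY ((R-21) currency; NO one-coset binder): the `hAκ2` binder of
★ `kappaModelSum_of_kappaStageB_complete` ∕ `kappaSignModelSum_of_kappaStageB_complete` VERBATIM (= the `hAκ2` of ED. 1, untouched by ED. 2: it carries `c` and the dichotomy explicitly, REF5 R5-99).  Payer road: LH4-p05 (g3) on ★ p856360∕p856385 (LH4-p14 (O2b)-MULT).  A sorried TARGET (pure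
lattice counting, not a census law). -/
theorem stub_U3_kappaStageA_typeTwo_mult :
    ∀ {K : Type} [Field K] [Valued K ℤᵐ⁰] [Finite 𝓀[K]] {σ : K →+* K}, (∀ x, σ (σ x) = x) → (∀ a, Valued.v (σ a) = Valued.v a) →
      ∀ {ϖ : K}, Valued.v ϖ = WithZero.exp (-1 : ℤ) → ∀ (ϖu : Kˣ), (ϖu : K) = ϖ →
      ∀ {c : K}, σ c = c → Valued.v c = 1 → (¬ ∃ z : K, z * σ z = c) →
        (∀ x : K, σ x = x → x ≠ 0 → (∃ z : K, z * σ z = x) ∨ ∃ z : K, z * σ z = c * x) →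
      ∀ {s : Fin 3 → K}, (∀ i, Valued.v (s i) = 1) → (∀ i j, i ≠ j → s i ≠ s j) →
      ∀ (T : GL (Fin 3) K), (T : Matrix (Fin 3) (Fin 3) K) = Matrix.diagonal s → ∀ (i : Fin 3),
        (((∑ e : Fin 3 → Bool,
            (![(if e 1 then -1 else 1) * (if e 2 then -1 else 1),
               (if e 0 then -1 else 1) * (if e 2 then -1 else 1),
               (if e 0 then -1 else 1) * (if e 1 then -1 else 1)] : Fin 3 → ℤ) i *
              ({M : Submodule 𝒪[K] (Fin 3 → K) |
                IsVertexLattice σ ϖ (Matrix.diagonal fun j => if e j then c else (1 : K)) 2 M ∧ mapGL T M = M}.ncard : ℤ) : ℤ) : ℚ)) =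
          8 * ∑ᶠ M₀ ∈ {M : Submodule 𝒪[K] (Fin 3 → K) | M ∈ normalisedStableLattices T ∧ IsTypeTwoPolarisable σ ϖ M},
            (kappaCount σ ϖ 2 i M₀ : ℚ) * stabiliserWeight σ M₀ :=
  F0P3cDyRamDiagonalKappaOrbitCountMult.kappaStageA_typeTwo_mult

/-- **(κ-B₀) `stub_U3_kappaCount_typeZero`** — THE TYPE-0 κ-STAGE-B SUM of (KMS): the `hBκ10` binder of the ★ ED. 2 head `kappaModelSum_of_kappaStageB_complete` VERBATIM (over COMPLETE valued fields with finite residue field — `[CompleteSpace K]` is load-bearing: REF5 (g22) R5-96∕R5-97 exhibit a non-complete model with `kappaCount ≡ 0`) (stratum by stratum: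
`Σᶠ_{stratum a} kappaCount·stabiliserWeight`, T-strata = `ω(−1)·[s ≥ 2d]·★B4`, core dead, G∕H∕glue new).  A sorried TARGET — an empirical census law in model currency.
PAID since ED. 11 BY NAME: theorem line over ★ `F0P3cDyRamKappaCountTypeZeroPaid.kappaCount_typeZero` (F0P3a-p01 (g32) p856938 = ★ p856859 `kappaCount_typeZero_of_boxSum` applied to ★ p856906 `sum_box_kappa_eq_typeZero`, LH4-p14 (g3)). -/
theorem stub_U3_kappaCount_typeZero :
    ∀ {K : Type} [Field K] [Valued K ℤᵐ⁰] [CompleteSpace K] [Fintype 𝓀[K]] {σ : K →+* K} {ϖ : K} {d t : ℕ}, IsRamifiedQuadraticDatum σ ϖ d t →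
      Valued.v (2 : K) < 1 → ∀ {α β : K} {n₁ n₂ n₃ : ℕ}, IsElementDatum σ ϖ (depthOfRecord d) α β n₁ n₂ n₃ →
      ∀ (T : GL (Fin 3) K), (T : Matrix (Fin 3) (Fin 3) K) = Matrix.diagonal ![α, β, 1] → ∀ (k : ℕ), 2 * k + d = n₁ + n₂ + n₃ + 2 →
      ∀ (i : Fin 3) (B : ℤ), 2 * B = ((![n₁, n₂, n₃] : Fin 3 → ℕ) i : ℤ) - d + 2 - 2 * shiftR d t →
        |∑ᶠ M ∈ {M : Submodule 𝒪[K] (Fin 3 → K) | M ∈ normalisedStableLattices T ∧ IsDualisableLattice σ ϖ M},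
            (kappaCount σ ϖ 0 i M : ℚ) * stabiliserWeight σ M| = ampl (Fintype.card 𝓀[K]) k B / 4 :=
  Summit.HodgeConjecture.HodgeConjecture.Cruxes.H413.F0P3cDyRamKappaCountTypeZeroPaid.kappaCount_typeZero
  -- PAID ED. 11 (★ `F0P3cDyRamKappaCountTypeZeroPaid` p856938; (κ-B₀) closed)

/-- **(κ-B₂) `stub_U3_kappaCount_typeTwo_mult`** — THE TYPE-2 κ-STAGE-B SUM of (KMS) WITH MULTIPLICITY: the `hBκ10₂` binder of the ★ ED. 2 head `kappaModelSum_of_kappaStageB_complete` VERBATIM (`[CompleteSpace K]` load-bearing).  A sorried TARGET — an empirical census law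
in model currency.
PAID since ED. 12 BY NAME: theorem line over ★ `F0P3cDyRamKappaCountTypeTwoPaid.kappaCount_typeTwo_mult` (LH4-p11 (g3) p856993 = ★ p856967 `kappaCount_typeTwo_mult_of_boxSum` applied to ★ p856964 `sum_box_kappa_eq_typeTwo`). -/
theorem stub_U3_kappaCount_typeTwo_mult :
    ∀ {K : Type} [Field K] [Valued K ℤᵐ⁰] [CompleteSpace K] [Fintype 𝓀[K]] {σ : K →+* K} {ϖ : K} {d t : ℕ}, IsRamifiedQuadraticDatum σ ϖ d t →
      Valued.v (2 : K) < 1 → ∀ {α β : K} {n₁ n₂ n₃ : ℕ}, IsElementDatum σ ϖ (depthOfRecord d) α β n₁ n₂ n₃ →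
      ∀ (T : GL (Fin 3) K), (T : Matrix (Fin 3) (Fin 3) K) = Matrix.diagonal ![α, β, 1] → ∀ (k : ℕ), 2 * k + d = n₁ + n₂ + n₃ + 2 →
      ∀ (i : Fin 3) (B : ℤ), 2 * B = ((![n₁, n₂, n₃] : Fin 3 → ℕ) i : ℤ) - d + 2 - 2 * shiftR d t →
        |∑ᶠ M ∈ {M : Submodule 𝒪[K] (Fin 3 → K) | M ∈ normalisedStableLattices T ∧ IsTypeTwoPolarisable σ ϖ M},
            (kappaCount σ ϖ 2 i M : ℚ) * stabiliserWeight σ M| = ampl (Fintype.card 𝓀[K]) k (B + tauOfRecord d) / 4 :=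
  Summit.HodgeConjecture.HodgeConjecture.Cruxes.H413.F0P3cDyRamKappaCountTypeTwoPaid.kappaCount_typeTwo_mult
  -- PAID ED. 12 (★ `F0P3cDyRamKappaCountTypeTwoPaid` p856993; (κ-B₂) closed)


/-- **`stub_U3_kappaModelSum`** (ED. 6, (R-18)) — (KMS) «THE κ-MODEL SUM»: THE κ-AMPLITUDE LAW IN DIAGONAL-MODEL CURRENCY, EIGHTFOLD and ω-FREE, behind the dyadic fence and the datum,
at the parameters of record.  For a `σ`-fixed unit `c` with the index-two dichotomy, an element datum `(α, β; n₁, n₂, n₃)` at `depthOfRecord d`, `T = diag(α, β, 1)`, `2k + d = Σn + 2`,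
`i : Fin 3` and the RE-CUT parity datum `2B = n_i − d + 2 − 2·shiftR d t`:  `|Σ_{s : Fin 3 → Bool} χ⁰_i(s) · C₀(s)| = 2·ampl q k B` and `|Σ_s χ⁰_i(s) · C₂(s)| = 2·ampl q k (B + τ d)`,
`C_t(s) = #{M : M a type-t vertex lattice of (K³, diag(d_s)), T·M = M}` (`d_s j = c` if `s j` else `1`), `χ⁰_0(s) = sgn(s 1)sgn(s 2)`, `χ⁰_1(s) = sgn(s 0)sgn(s 2)`, `χ⁰_2(s) = sgn(s 0)sgn(s 1)`
(`sgn b = −1` if `b` else `1`) — the κ-weighted, per-class refinement of (MS) (same index set `s`, same prefix as `stub_U3_stableModelSum`; the (S-fin) engine's per-(class, type) counts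
are its data).  With (NI2) ★ `normIndexTwo` it PAYS `stub_U3_kappaAbsLawR` by ★ p855529 `dyadicFence_kappaAmplitudeLawAtR_of_kappaModelSum8` (census owner F0P3-p01 (g30) 23:02∕23:05Z,
REF5 R5-39∕R5-40 «=» (fence + datum guard: the unguarded `∀ d` shape is refuted by d-decoupling), LH4-r01 BOX BC, REF1 BOX #89).  A sorried TARGET — an empirical census law in model
currency, NOT a literature fact.  RISK LINE: «κ-amplitude law of record = census law (520∕520 + RC-1 re-cut `shiftR` at d < t: e2c «=», in range at e3b (2,4,6) 12∕12 and e3a4 6∕6;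
untested: even d ≥ 6 < t, q ≥ 4 at d < t); KMS = its per-class diagonal-model refinement (digits e3b (6,6,12), i = 1: (8192, 12288) = 2× BOX BB); K-SGN sign factor at d < t = TW4
(kit j348006) standing falsifier — K-SGN-R untouched by this edition». -/
theorem stub_U3_kappaModelSum :
    ∀ {K : Type} [Field K] [Valued K ℤᵐ⁰] [CompleteSpace K] [Fintype 𝓀[K]] (σ : K →+* K) (ϖ : K) (d t : ℕ),
      DyadicFence (K := K) (IsRamifiedQuadraticDatum σ ϖ d t →
        ∀ c : K, σ c = c → Valued.v c = 1 → (∀ x : K, σ x = x → x ≠ 0 → (∃ z : K, z * σ z = x) ∨ ∃ z : K, z * σ z = c * x) →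
        ∀ (α β : K) (n₁ n₂ n₃ : ℕ), IsElementDatum σ ϖ (depthOfRecord d) α β n₁ n₂ n₃ →
        ∀ (T : GL (Fin 3) K), (T : Matrix (Fin 3) (Fin 3) K) = Matrix.diagonal ![α, β, 1] →
        ∀ (k : ℕ), 2 * k + d = n₁ + n₂ + n₃ + 2 →
        ∀ (i : Fin 3) (B : ℤ), 2 * B = ((![n₁, n₂, n₃] : Fin 3 → ℕ) i : ℤ) - d + 2 - 2 * shiftR d t →
          |((∑ s : Fin 3 → Bool,
              (![(if s 1 then -1 else 1) * (if s 2 then -1 else 1),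
                 (if s 0 then -1 else 1) * (if s 2 then -1 else 1),
                 (if s 0 then -1 else 1) * (if s 1 then -1 else 1)] : Fin 3 → ℤ) i *
                ({M : Submodule 𝒪[K] (Fin 3 → K) |
                  IsVertexLattice σ ϖ (Matrix.diagonal fun j => if s j then c else (1 : K)) 0 M ∧ mapGL T M = M}.ncard : ℤ) : ℤ) : ℚ)| =
            2 * ampl (Fintype.card 𝓀[K]) k B ∧
          |((∑ s : Fin 3 → Bool,
              (![(if s 1 then -1 else 1) * (if s 2 then -1 else 1),
                 (if s 0 then -1 else 1) * (if s 2 then -1 else 1),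
                 (if s 0 then -1 else 1) * (if s 1 then -1 else 1)] : Fin 3 → ℤ) i *
                ({M : Submodule 𝒪[K] (Fin 3 → K) |
                  IsVertexLattice σ ϖ (Matrix.diagonal fun j => if s j then c else (1 : K)) 2 M ∧ mapGL T M = M}.ncard : ℤ) : ℤ) : ℚ)| =
            2 * ampl (Fintype.card 𝓀[K]) k (B + tauOfRecord d)) :=
  -- PAID ED. 10 BY COMPOSITION («KMS := (κ-A₂) ⊕ (κ-B₀) ⊕ (κ-B₂)», ★ ED. 2 head `kappaModelSum_of_kappaStageB_complete` (ED. 1 p856604 ∕ ED. 2 p856682); axioms = trio ∪ the `sorryAx` of exactly (κ-B₀)(κ-B₂))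
  F0P3cDyRamKappaModelSumOfKappaStageB.kappaModelSum_of_kappaStageB_complete
    stub_U3_kappaStageA_typeTwo_mult stub_U3_kappaCount_typeZero stub_U3_kappaCount_typeTwo_mult

/-- **`stub_U3_kappaAbsLawR`** (ED. 3; PAID since ED. 6 BY COMPOSITION ((R-18) «K-ABS-R := NI2 ⊕ KMS»: ★ p855529 over ★ p855402 + `stub_U3_kappaModelSum`)) — THE RE-CUT κ-AMPLITUDE LAW AT EVERY DATUM at the parameters of record, behind the fence:
`DyadicFence (KappaAmplitudeLawAtR depthOfRecord tauOfRecord σ ϖ d t)` (№1-R: parity datum `2B_i = n_i − d + 2 − 2(d − d mod 2)`; 520∕520 + 14∕14 of record by the agreement lemma,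
+ 54∕54 at e2c).  Desk row (K-ABS), LAW-FED, 2–5 files.  A sorried TARGET — an empirical census law, NOT a literature fact.  RISK LINE (LEAD T18-11 (4), verbatim): «t-free token: d ∈ {2,3,4,5} pinned (d = 2 at t ∈ {2,4,6}; d = 4 sub-threshold); in-range d = 4 and K-SGN = TW4 standing falsifiers». -/
theorem stub_U3_kappaAbsLawR :
    ∀ {K : Type} [Field K] [Valued K ℤᵐ⁰] [CompleteSpace K] [Fintype 𝓀[K]] (σ : K →+* K) (ϖ : K) (d t : ℕ),
      DyadicFence (K := K) (KappaAmplitudeLawAtR depthOfRecord tauOfRecord σ ϖ d t) := fun σ ϖ d t h2 hD =>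
  Summit.HodgeConjecture.HodgeConjecture.Cruxes.H413.F0P3cDyRamKappaAbsLawOfKappaModelSum.dyadicFence_kappaAmplitudeLawAtR_of_kappaModelSum8 σ ϖ d t
    (stub_U3_kappaModelSum σ ϖ d t h2 hD) h2 hD

/-! ## §K-R2  (ED. 13 «κS-RECUT (R-22)», heir LEAD F0P3a-plan (g19) T18-53 ORDER OF SHAPE; cutter LH4-p05 (g4)) the Ω-AWARE RE-LETTER of the sign half of §K-R at the SCHEDULE OF RECORD `omegaR`:
two re-lettered signed κ-Stage-B children (sorried targets), the re-lettered parents KSS² ∕ K-SGN-R2 PAID BY COMPOSITION (★ p856996 (iv) ∕ ★ p856997 (iii)), and the binder-free R2 assembly over ★ DEFS LEAF №1-R2 (p856987) -/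

/-- **(κS-B₀²) `stub_U3_kappaSignCount2_typeZero`** — THE RE-LETTERED SIGNED TYPE-0 κ-STAGE-B SUM of (KSS²) at the square datum: the struck (κS-B₀) sentence (ED. 10 :509) with its RHS sign multiplied by
the schedule of record `omegaR K σ ϖ d a b i` (the ORDER's `ΩR`, ASCII identifier `omegaR`; ★ `F0P3cDyRamOmegaRDefs.omegaR`, LH4-p10 (g3), = LH4-p04 (g2)'s glue sign `glueSignR σ ϖ d a b i = glueSign σ ϖ d ((b, a, b∕a)_i)`: the norm class of a σ-fixed representative of the
glue unit of axis `i` modulo `U_E^{(2d−1)}`, junk `1` where no representative exists — that axis has amplitude `0`); the `hBκS20` binder of ★ `kappaSignModelSum2_of_kappaStageB_complete omegaR` (p856996) VERBATIM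
(`[CompleteSpace K]` load-bearing, REF5 R5-96).  Why re-lettered: (κS-B₀) AS TYPED is MODEL-REFUTED at `(d,t) = (6,8)`, `e_F = 4` (REF5 (g22) R5-109 (3), LH4-r01 (g4) GD∕GD2, LHref-N #343 `cft68.py`, ref4 R4-127):
there `Ω(b∕a) = −1` while the ED. 10 token reads `+1`; on the covered set `d % 2 = 1 ∨ 2 * d ≤ t + 2` (every row of record) `omegaR = 1` on every READ axis (amplitude `≠ 0`; unread odd-branch axes may
carry `ω = −1`, REF5 R5-122 (1) ∕ R5-130 (4)), so there this sentence carries exactly the struck one's content (bridge ★ p857007 `kappaSignLawAtR2_iff_kappaSignLawAtR_of_forall_eq_one_or_ampl_eq_zero`,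
discharged at `omegaR` by LH4-p10 (g3)'s `…KappaSignLawR2OfRecord` over LH4-p04 (g2)'s ★ `…GlueSignEval`).
A sorried TARGET — an empirical census law in model currency.
PAID since ED. 14 BY NAME: theorem line over ★ `F0P3cDyRamKappaSignCount2TypeZero.kappaSignCount2_typeZero` (LH4-p04 (g3) p857128 = ★ (A) p857082 ⊕ ★ (C0) p857084 ⊕ ★ (C1) p857107, plan b501bd1f; TYPE ≡ :592 by `rfl` tie REF1 #202 ∕ LH-ref2 #19). -/
theorem stub_U3_kappaSignCount2_typeZero :
    ∀ {K : Type} [Field K] [Valued K ℤᵐ⁰] [CompleteSpace K] [Fintype 𝓀[K]] {σ : K →+* K} {ϖ : K} {d t : ℕ}, IsRamifiedQuadraticDatum σ ϖ d t →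
      Valued.v (2 : K) < 1 → ∀ {δ : K}, σ δ = -δ → δ ≠ 0 →
      ∀ {a b : K}, a * σ a = 1 → b * σ b = 1 → Valued.v (a - 1) < Valued.v (2 : K) → Valued.v (b - 1) < Valued.v (2 : K) →
      ∀ {n₁ n₂ n₃ : ℕ}, IsElementDatum σ ϖ (depthOfRecord d) (a * a) (b * b) n₁ n₂ n₃ →
      ∀ (T : GL (Fin 3) K), (T : Matrix (Fin 3) (Fin 3) K) = Matrix.diagonal ![a * a, b * b, 1] → ∀ (k : ℕ), 2 * k + d = n₁ + n₂ + n₃ + 2 →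
      ∀ (i : Fin 3) (B : ℤ), 2 * B = ((![n₁, n₂, n₃] : Fin 3 → ℕ) i : ℤ) - d + 2 - 2 * shiftR d t →
        ∑ᶠ M ∈ {M : Submodule 𝒪[K] (Fin 3 → K) | M ∈ normalisedStableLattices T ∧ IsDualisableLattice σ ϖ M},
            (kappaCount σ ϖ 0 i M : ℚ) * stabiliserWeight σ M =
          ((omegaR K σ ϖ d a b i * ((![normSign σ (-1 : K), normSign σ (-1 : K), 1] : Fin 3 → ℤ) i *
            (baseSign σ i * normSign σ (fPartProd δ ![a, b, 1] i))) : ℤ) : ℚ) * ampl (Fintype.card 𝓀[K]) k B / 4 :=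
  Summit.HodgeConjecture.HodgeConjecture.Cruxes.H413.F0P3cDyRamKappaSignCount2TypeZero.kappaSignCount2_typeZero
  -- PAID ED. 14 (★ `F0P3cDyRamKappaSignCount2TypeZero` p857128; (κS-B₀²) closed)

/-- **(κS-B₂²) `stub_U3_kappaSignCount2_typeTwo_mult`** — THE RE-LETTERED SIGNED TYPE-2 κ-STAGE-B SUM of (KSS²) WITH MULTIPLICITY: the struck (κS-B₂) sentence (ED. 10 :524) with its RHS sign multiplied
by `omegaR K σ ϖ d a b i` — the SAME factor as at type 0 (T18-53 Q5, REF5 R5-115 (3): the Ω factor is type-blind germ algebra); the `hBκS20₂` binder of ★ `kappaSignModelSum2_of_kappaStageB_complete omegaR` VERBATIM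
(`[CompleteSpace K]` load-bearing).  Why re-lettered: (κS-B₂) AS TYPED is MODEL-REFUTED already at the census cell of record e2b `(d,t) = (4,4)`, `e_F = 2`, `q = 2` (REF5 (g22) R5-114 (B), ref4 R4-129: boundary cell
`(12,10,10)`, `k = 15`, `Ω(b∕a) = ω(W₀) = −1`); covered set for type 2: `d % 2 = 1 ∨ 2 * d ≤ t + 2`.  A sorried TARGET — an empirical census law in model currency.
PAID since ED. 15 BY NAME: theorem line over ★ `F0P3cDyRamKappaSignCount2TypeTwoMult.kappaSignCount2_typeTwo_mult` (LH4-p07 (g6) p857148 = ★ (A₂) p857083 ⊕ ★ (C0) p857084 ⊕ ★ (C1) p857107 ⊕ ★ (D) §0 p857128, plan b501bd1f; TYPE ≡ ED. 13 :609 by tie REF1 #205 ∕ LH4-p11 (g4)). -/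
theorem stub_U3_kappaSignCount2_typeTwo_mult :
    ∀ {K : Type} [Field K] [Valued K ℤᵐ⁰] [CompleteSpace K] [Fintype 𝓀[K]] {σ : K →+* K} {ϖ : K} {d t : ℕ}, IsRamifiedQuadraticDatum σ ϖ d t →
      Valued.v (2 : K) < 1 → ∀ {δ : K}, σ δ = -δ → δ ≠ 0 →
      ∀ {a b : K}, a * σ a = 1 → b * σ b = 1 → Valued.v (a - 1) < Valued.v (2 : K) → Valued.v (b - 1) < Valued.v (2 : K) →
      ∀ {n₁ n₂ n₃ : ℕ}, IsElementDatum σ ϖ (depthOfRecord d) (a * a) (b * b) n₁ n₂ n₃ →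
      ∀ (T : GL (Fin 3) K), (T : Matrix (Fin 3) (Fin 3) K) = Matrix.diagonal ![a * a, b * b, 1] → ∀ (k : ℕ), 2 * k + d = n₁ + n₂ + n₃ + 2 →
      ∀ (i : Fin 3) (B : ℤ), 2 * B = ((![n₁, n₂, n₃] : Fin 3 → ℕ) i : ℤ) - d + 2 - 2 * shiftR d t →
        ∑ᶠ M ∈ {M : Submodule 𝒪[K] (Fin 3 → K) | M ∈ normalisedStableLattices T ∧ IsTypeTwoPolarisable σ ϖ M},
            (kappaCount σ ϖ 2 i M : ℚ) * stabiliserWeight σ M =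
          ((omegaR K σ ϖ d a b i * ((![normSign σ (-1 : K), normSign σ (-1 : K), 1] : Fin 3 → ℤ) i *
            (baseSign σ i * normSign σ (fPartProd δ ![a, b, 1] i))) : ℤ) : ℚ) * ampl (Fintype.card 𝓀[K]) k (B + tauOfRecord d) / 4 :=
  Summit.HodgeConjecture.HodgeConjecture.Cruxes.H413.F0P3cDyRamKappaSignCount2TypeTwoMult.kappaSignCount2_typeTwo_mult
  -- PAID ED. 15 (★ `F0P3cDyRamKappaSignCount2TypeTwoMult` p857148; (κS-B₂²) closed — §K-R2 sorry-free)

/-- **`stub_U3_kappaSignModelSum2`** — (KSS²) «THE Ω-AWARE SIGNED κ-MODEL SUM»: the struck KSS sentence (ED. 10 :592) with the sign of BOTH conjuncts multiplied by the schedule of record `omegaR K σ ϖ d a b i`: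
behind the dyadic fence, at a ramified quadratic datum, for a `σ`-fixed unit `c` with the index-two dichotomy, an anti-fixed `δ ≠ 0`, `a, b ∈ E¹` under the root guard, the square element datum
`(a², b²; n₁, n₂, n₃)` at `depthOfRecord d`, `T = diag(a², b², 1)`, `2k + d = Σn + 2`, `i` and the re-cut parity datum `2B = n_i − d + 2 − 2·shiftR d t`:
`Σ_s χ⁰_i(s)·C₀(s) = 2·(Ω_i·w_i·S_i)·ampl q k B ∧ Σ_s χ⁰_i(s)·C₂(s) = 2·(Ω_i·w_i·S_i)·ampl q k (B + τ d)`, `Ω_i = omegaR K σ ϖ d a b i`, `w = (ω(−1), ω(−1), 1)`, `S_i = baseSign σ i · ω(fPartProd δ (a,b,1) i)`.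
PAID AT BIRTH BY COMPOSITION («KSS² := (κ-A₂) ⊕ (κS-B₀²) ⊕ (κS-B₂²)»): the bare application of ★ `F0P3cDyRamKappaSignModelSum2OfKappaStageB.kappaSignModelSum2_of_kappaStageB_complete omegaR` (p856996, LH4-p05 (g4);
over the ★ sign-token-generic engine p856977) to (κ-A₂) `stub_U3_kappaStageA_typeTwo_mult` (★-paid) and the two children above; axioms = trio ∪ the `sorryAx` of exactly (κS-B₀²)(κS-B₂²).  Its statement after the
fence∕datum binder is the `hKSS` binder of ★ `dyadicFence_kappaSignLawAtR2_of_kappaSignModelSum2_8 omegaR` (p856997) token for token.  A TARGET (census law in model currency), NOT a literature fact. -/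
theorem stub_U3_kappaSignModelSum2 :
    ∀ {K : Type} [Field K] [Valued K ℤᵐ⁰] [CompleteSpace K] [Fintype 𝓀[K]] (σ : K →+* K) (ϖ : K) (d t : ℕ),
      DyadicFence (K := K) (IsRamifiedQuadraticDatum σ ϖ d t →
        ∀ c : K, σ c = c → Valued.v c = 1 → (∀ x : K, σ x = x → x ≠ 0 → (∃ z : K, z * σ z = x) ∨ ∃ z : K, z * σ z = c * x) →
        ∀ (δ : K), σ δ = -δ → δ ≠ 0 →
        ∀ (a b : K), a * σ a = 1 → b * σ b = 1 → Valued.v (a - 1) < Valued.v (2 : K) → Valued.v (b - 1) < Valued.v (2 : K) →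
        ∀ (n₁ n₂ n₃ : ℕ), IsElementDatum σ ϖ (depthOfRecord d) (a * a) (b * b) n₁ n₂ n₃ →
        ∀ (T : GL (Fin 3) K), (T : Matrix (Fin 3) (Fin 3) K) = Matrix.diagonal ![a * a, b * b, 1] →
        ∀ (k : ℕ), 2 * k + d = n₁ + n₂ + n₃ + 2 →
        ∀ (i : Fin 3) (B : ℤ), 2 * B = ((![n₁, n₂, n₃] : Fin 3 → ℕ) i : ℤ) - d + 2 - 2 * shiftR d t →
          ((∑ s : Fin 3 → Bool,
              (![(if s 1 then -1 else 1) * (if s 2 then -1 else 1),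
                 (if s 0 then -1 else 1) * (if s 2 then -1 else 1),
                 (if s 0 then -1 else 1) * (if s 1 then -1 else 1)] : Fin 3 → ℤ) i *
                ({M : Submodule 𝒪[K] (Fin 3 → K) |
                  IsVertexLattice σ ϖ (Matrix.diagonal fun j => if s j then c else (1 : K)) 0 M ∧ mapGL T M = M}.ncard : ℤ) : ℤ) : ℚ) =
            2 * ((omegaR K σ ϖ d a b i * ((![normSign σ (-1 : K), normSign σ (-1 : K), 1] : Fin 3 → ℤ) i *
              (baseSign σ i * normSign σ (fPartProd δ ![a, b, 1] i))) : ℤ) : ℚ) * ampl (Fintype.card 𝓀[K]) k B ∧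
          ((∑ s : Fin 3 → Bool,
              (![(if s 1 then -1 else 1) * (if s 2 then -1 else 1),
                 (if s 0 then -1 else 1) * (if s 2 then -1 else 1),
                 (if s 0 then -1 else 1) * (if s 1 then -1 else 1)] : Fin 3 → ℤ) i *
                ({M : Submodule 𝒪[K] (Fin 3 → K) |
                  IsVertexLattice σ ϖ (Matrix.diagonal fun j => if s j then c else (1 : K)) 2 M ∧ mapGL T M = M}.ncard : ℤ) : ℤ) : ℚ) =
            2 * ((omegaR K σ ϖ d a b i * ((![normSign σ (-1 : K), normSign σ (-1 : K), 1] : Fin 3 → ℤ) i *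
              (baseSign σ i * normSign σ (fPartProd δ ![a, b, 1] i))) : ℤ) : ℚ) * ampl (Fintype.card 𝓀[K]) k (B + tauOfRecord d)) :=
  -- PAID AT BIRTH BY COMPOSITION («KSS² := (κ-A₂) ⊕ (κS-B₀²) ⊕ (κS-B₂²)», ★ (iv) p856996 over the ★ engine p856977; axioms = trio ∪ the `sorryAx` of exactly (κS-B₀²)(κS-B₂²))
  F0P3cDyRamKappaSignModelSum2OfKappaStageB.kappaSignModelSum2_of_kappaStageB_complete omegaR
    stub_U3_kappaStageA_typeTwo_mult stub_U3_kappaSignCount2_typeZero stub_U3_kappaSignCount2_typeTwo_mult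

/-- **`stub_U3_kappaSignLawR2`** — (K-SGN-R2) THE Ω-AWARE RE-CUT κ-SIGN LAW AT EVERY DATUM at the schedule of record, behind the fence: `DyadicFence (KappaSignLawAtR2 omegaR depthOfRecord tauOfRecord σ ϖ d t)`
(★ DEFS LEAF №1-R2 p856987: `KappaSignLawAtR2 Ω N₀ τ := KappaSignLawAtS2 shiftR Ω N₀ τ` = ★ №1-R's `KappaSignLawAtS shiftR` with the RHS sign `Ω K σ ϖ d a b i * (baseSign σ i * normSign σ (fPartProd δ ![a, b, 1] i))`;
custody tie at the trivial token `KappaSignLawAtR2 omegaOne … ↔ KappaSignLawAtR …`).  Replaces the struck `stub_U3_kappaSignLawR` (ED. 3∕7 :625), false as a ∀-sentence under (R-22).  PAID AT BIRTH BY COMPOSITION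
(«K-SGN-R2 := NI2 ⊕ KSS²»: ★ `F0P3cDyRamKappaSignLawR2OfKappaSignModelSum.dyadicFence_kappaSignLawAtR2_of_kappaSignModelSum2_8 omegaR` (p856997, LH4-p10 (g3); over ★ NI2 p855402 and ★ p855598's algebra with the
token riding through) applied to `stub_U3_kappaSignModelSum2`).  On the covered set `d % 2 = 1 ∨ 2 * d ≤ t + 2` (every row of record: (2,2), (3,2), e2c …) the consumers of the sign conjunct get ★ №1-R's
`KappaSignLawAtR` back through the bridge ★ p857007 `kappaSignLawAtR2_iff_kappaSignLawAtR_of_forall_eq_one_or_ampl_eq_zero omegaR` (token `= 1` on every READ axis, both amplitudes `0` on the dead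
ones) discharged by LH4-p10 (g3)'s `…KappaSignLawR2OfRecord` over LH4-p04 (g2)'s ★ `…GlueSignEval` (heir LEAD T18-53 (H2)).  Desk row (K-SGN), LAW-FED.  A TARGET. -/
theorem stub_U3_kappaSignLawR2 :
    ∀ {K : Type} [Field K] [Valued K ℤᵐ⁰] [CompleteSpace K] [Fintype 𝓀[K]] (σ : K →+* K) (ϖ : K) (d t : ℕ),
      DyadicFence (K := K) (KappaSignLawAtR2 omegaR depthOfRecord tauOfRecord σ ϖ d t) := fun σ ϖ d t h2 hD =>
  Summit.HodgeConjecture.HodgeConjecture.Cruxes.H413.F0P3cDyRamKappaSignLawR2OfKappaSignModelSum.dyadicFence_kappaSignLawAtR2_of_kappaSignModelSum2_8 omegaR σ ϖ d t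
    (stub_U3_kappaSignModelSum2 σ ϖ d t h2 hD) h2 hD

/-- **§K-R2 · ★ №1-R2's CLOSED PROP `FourFrameLawsWildOfRecordR2 Ω` BY NAME, modulo the re-cut κ-cuts as BINDERS** (the R2 twin of `u3_fourFrameLawsWildOfRecordR_of_kappa`, any schedule `Ω`; when §K-R2 is paid the
binders are `stub_U3_kappaAbsLawR` ∕ `stub_U3_kappaSignLawR2` at `Ω := omegaR`).  Sorry-free modulo the two §S stubs (★ `fourFrameLawsWildAtR2_of_fenced`). -/
theorem u3_fourFrameLawsWildOfRecordR2_of_kappa (Ω : OmegaSchedule)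
    (hKA : ∀ {K : Type} [Field K] [Valued K ℤᵐ⁰] [CompleteSpace K] [Fintype 𝓀[K]] (σ : K →+* K) (ϖ : K) (d t : ℕ),
      DyadicFence (K := K) (KappaAmplitudeLawAtR depthOfRecord tauOfRecord σ ϖ d t))
    (hKS : ∀ {K : Type} [Field K] [Valued K ℤᵐ⁰] [CompleteSpace K] [Fintype 𝓀[K]] (σ : K →+* K) (ϖ : K) (d t : ℕ),
      DyadicFence (K := K) (KappaSignLawAtR2 Ω depthOfRecord tauOfRecord σ ϖ d t)) :
    FourFrameLawsWildOfRecordR2 Ω :=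
  fun σ ϖ d t => fourFrameLawsWildAtR2_of_fenced Ω depthOfRecord tauOfRecord σ ϖ d t (u3_stableLaw_ofRecord σ ϖ d t) (hKA σ ϖ d t) (hKS σ ϖ d t)

/-- **§K-R2 · ★ №1-R2's CLOSED PROP AT THE SCHEDULE OF RECORD, `FourFrameLawsWildOfRecordR2 omegaR`, BY NAME, binder-free** — replaces the struck `u3_fourFrameLawsWildOfRecordR` (a false closed Prop under (R-22)).
Sorry-free composition (axioms = trio ∪ `sorryAx` of the open law stubs: (κ-B₂) through K-ABS-R, (κS-B₀²)(κS-B₂²) through K-SGN-R2). -/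
theorem u3_fourFrameLawsWildOfRecordR2 : FourFrameLawsWildOfRecordR2 omegaR :=
  u3_fourFrameLawsWildOfRecordR2_of_kappa omegaR stub_U3_kappaAbsLawR stub_U3_kappaSignLawR2

/-- **§K-R2 · THE THREE Ω-AWARE RE-CUT LAW BINDERS AT ONCE**, at the parameters of record and a schedule `Ω`, at a datum with `¬ IsUnit (2 : 𝒪[K])`, from ★ №1-R2's closed Prop `FourFrameLawsWildOfRecordR2 Ω` — the
one-name hand-off to the tier-0 consumers after the κS-recut (R2 twin of `u3_lawsAt_of_wildOfRecordR`).  TRIO. -/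
theorem u3_lawsAt_of_wildOfRecordR2 {Ω : OmegaSchedule} (h : FourFrameLawsWildOfRecordR2 Ω) {K : Type} [Field K] [Valued K ℤᵐ⁰] [CompleteSpace K] [Fintype 𝓀[K]]
    (σ : K →+* K) (ϖ : K) (d t : ℕ) (h2 : ¬ IsUnit (2 : 𝒪[K])) :
    StableLawAt depthOfRecord σ ϖ d t ∧ KappaAmplitudeLawAtR depthOfRecord tauOfRecord σ ϖ d t ∧ KappaSignLawAtR2 Ω depthOfRecord tauOfRecord σ ϖ d t :=
  h σ ϖ d t (u3_v_two_lt_one_of_not_isUnit_two h2)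

/-- §K-R2 · the three Ω-aware re-cut law binders at the SCHEDULE OF RECORD `omegaR`, at a datum with `¬ IsUnit (2 : 𝒪[K])`, binder-free — replaces the struck `u3_lawsAtR_of_not_isUnit_two` (its third conjunct re-pointed
to `KappaSignLawAtR2 omegaR`, T18-53 Q2). -/
theorem u3_lawsAtR2_of_not_isUnit_two {K : Type} [Field K] [Valued K ℤᵐ⁰] [CompleteSpace K] [Fintype 𝓀[K]]
    (σ : K →+* K) (ϖ : K) (d t : ℕ) (h2 : ¬ IsUnit (2 : 𝒪[K])) :
    StableLawAt depthOfRecord σ ϖ d t ∧ KappaAmplitudeLawAtR depthOfRecord tauOfRecord σ ϖ d t ∧ KappaSignLawAtR2 omegaR depthOfRecord tauOfRecord σ ϖ d t :=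
  u3_lawsAt_of_wildOfRecordR2 u3_fourFrameLawsWildOfRecordR2 σ ϖ d t h2

/-- §K-R2 · the UNFENCED Ω-aware re-cut (K-SGN-R2) cut at a dyadic datum, at `omegaR` — replaces the struck `u3_kappaSignLawAtR_of_v_two_lt_one`; feeds `u3_edgeKappaRow_of_kappaSignS2 shiftR omegaR`'s `hKS`. -/
theorem u3_kappaSignLawAtR2_of_v_two_lt_one {K : Type} [Field K] [Valued K ℤᵐ⁰] [CompleteSpace K] [Fintype 𝓀[K]] (σ : K →+* K) (ϖ : K) (d t : ℕ)
    (h2 : Valued.v (2 : K) < 1) : KappaSignLawAtR2 omegaR depthOfRecord tauOfRecord σ ϖ d t :=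
  stub_U3_kappaSignLawR2 σ ϖ d t h2

/-- **§K-R2 · THE SIGNED EDGE ROW, DOUBLY SCHEDULED** (R2 twin of `u3_edgeKappaRow_of_kappaSignS`): for ANY depth-shift schedule `shift` and ANY sign-token schedule `Ω`, the (K-SGN-S2) cut
`KappaSignLawAtS2 shift Ω …` (binder `hKS`) and the edge identity `stub_U3_edgeLaw_t2` give `Σ_b κ_i(b)·e(Γ_b) = (Ω_i·S_i)·(ampl k B + ampl k (B + τ d))` for the parity datum
`2B = n_i − d + 2 − 2·shift d t` — the token rides through the (K-1)(c) transcription untouched (`shift := shiftR`, `Ω := omegaR` is the edge row of record after the recut).  Sorry-free modulo `stub_U3_edgeLaw_t2` (PAID). -/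
theorem u3_edgeKappaRow_of_kappaSignS2 (shift : ℕ → ℕ → ℤ) (Ω : OmegaSchedule) {K : Type} [Field K] [Valued K ℤᵐ⁰] [CompleteSpace K] [Fintype 𝓀[K]] (σ : K →+* K) (ϖ : K) (d t : ℕ)
    (hKS : KappaSignLawAtS2 shift Ω depthOfRecord tauOfRecord σ ϖ d t)
    (h2 : Valued.v (2 : K) < 1) (hD : IsRamifiedQuadraticDatum σ ϖ d t)
    (f : Fin 4 → Fin 3 → (Fin 3 → K)) (hf : IsFourFrameFamily σ f)
    (δ : K) (hδ : σ δ = -δ) (hδ0 : δ ≠ 0)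
    (a b : K) (ha : a * σ a = 1) (hb : b * σ b = 1) (ha2 : Valued.v (a - 1) < Valued.v (2 : K)) (hb2 : Valued.v (b - 1) < Valued.v (2 : K))
    (n₁ n₂ n₃ : ℕ) (hE : IsElementDatum σ ϖ (depthOfRecord d) (a * a) (b * b) n₁ n₂ n₃)
    (Γ : Fin 4 → GL (Fin 3) K) (hΓ : ∀ b', (Γ b' : Matrix (Fin 3) (Fin 3) K) = frameElt σ f b' (a * a) (b * b))
    (k : ℕ) (hk : 2 * k + d = n₁ + n₂ + n₃ + 2)
    (i : Fin 3) (B : ℤ) (hB : 2 * B = ((![n₁, n₂, n₃] : Fin 3 → ℕ) i : ℤ) - d + 2 - 2 * shift d t) :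
    ((∑ b' : Fin 4, kappaChar i b' * (fixedEdgeCount σ ϖ (Γ b') : ℤ) : ℤ) : ℚ) =
      (Ω K σ ϖ d a b i * (baseSign σ i * normSign σ (fPartProd δ ![a, b, 1] i)) : ℤ) *
        (ampl (Fintype.card 𝓀[K]) k B + ampl (Fintype.card 𝓀[K]) k (B + tauOfRecord d)) := by
  obtain ⟨h0, h2'⟩ := hKS hD f hf δ hδ hδ0 a b ha hb ha2 hb2 n₁ n₂ n₃ hE Γ hΓ k hk i B hB
  have hid := stub_U3_edgeLaw_t2 σ ϖ d t h2 hD f hf (a * a) (b * b) n₁ n₂ n₃ hE Γ hΓ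
  have hb' : ∀ b' : Fin 4, (fixedEdgeCount σ ϖ (Γ b') : ℤ) = fixedVertexCount σ ϖ 0 (Γ b') + fixedVertexCount σ ϖ 2 (Γ b') - 1 := by
    intro b'
    have := congrArg (fun n : ℕ => (n : ℤ)) (hid b')
    push_cast at this
    linarith
  have hsum : (∑ b' : Fin 4, kappaChar i b' * (fixedEdgeCount σ ϖ (Γ b') : ℤ) : ℤ) =
      (∑ b' : Fin 4, kappaChar i b' * (fixedVertexCount σ ϖ 0 (Γ b') : ℤ)) +
        (∑ b' : Fin 4, kappaChar i b' * (fixedVertexCount σ ϖ 2 (Γ b') : ℤ)) - ∑ b' : Fin 4, kappaChar i b' := by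
    simp_rw [hb', ← Finset.sum_add_distrib, ← Finset.sum_sub_distrib]
    exact Finset.sum_congr rfl fun _ _ => by ring
  rw [hsum, u3_sum_kappaChar_eq_zero, sub_zero]
  push_cast at h0 h2' ⊢
  rw [h0, h2']
  ring

/-- §K-R2 · the signed edge row OF RECORD after the recut: `shift := shiftR`, `Ω := omegaR`, the (K-SGN-R2) cut supplied by `u3_kappaSignLawAtR2_of_v_two_lt_one` — binder-free but for the datum (replaces the ED. 3 road
`u3_edgeKappaRow_of_kappaSignS shiftR … (u3_kappaSignLawAtR_of_v_two_lt_one …)` through the struck cone). -/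
theorem u3_edgeKappaRow_ofRecordR2 {K : Type} [Field K] [Valued K ℤᵐ⁰] [CompleteSpace K] [Fintype 𝓀[K]] (σ : K →+* K) (ϖ : K) (d t : ℕ)
    (h2 : Valued.v (2 : K) < 1) (hD : IsRamifiedQuadraticDatum σ ϖ d t)
    (f : Fin 4 → Fin 3 → (Fin 3 → K)) (hf : IsFourFrameFamily σ f)
    (δ : K) (hδ : σ δ = -δ) (hδ0 : δ ≠ 0)
    (a b : K) (ha : a * σ a = 1) (hb : b * σ b = 1) (ha2 : Valued.v (a - 1) < Valued.v (2 : K)) (hb2 : Valued.v (b - 1) < Valued.v (2 : K))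
    (n₁ n₂ n₃ : ℕ) (hE : IsElementDatum σ ϖ (depthOfRecord d) (a * a) (b * b) n₁ n₂ n₃)
    (Γ : Fin 4 → GL (Fin 3) K) (hΓ : ∀ b', (Γ b' : Matrix (Fin 3) (Fin 3) K) = frameElt σ f b' (a * a) (b * b))
    (k : ℕ) (hk : 2 * k + d = n₁ + n₂ + n₃ + 2)
    (i : Fin 3) (B : ℤ) (hB : 2 * B = ((![n₁, n₂, n₃] : Fin 3 → ℕ) i : ℤ) - d + 2 - 2 * shiftR d t) :
    ((∑ b' : Fin 4, kappaChar i b' * (fixedEdgeCount σ ϖ (Γ b') : ℤ) : ℤ) : ℚ) =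
      (omegaR K σ ϖ d a b i * (baseSign σ i * normSign σ (fPartProd δ ![a, b, 1] i)) : ℤ) *
        (ampl (Fintype.card 𝓀[K]) k B + ampl (Fintype.card 𝓀[K]) k (B + tauOfRecord d)) :=
  u3_edgeKappaRow_of_kappaSignS2 shiftR omegaR σ ϖ d t (u3_kappaSignLawAtR2_of_v_two_lt_one σ ϖ d t h2) h2 hD f hf δ hδ hδ0 a b ha hb ha2 hb2 n₁ n₂ n₃ hE Γ hΓ k hk i B hB


end Summit.HodgeConjecture.HodgeConjecture.Cruxes.H413.F0P3cDyRamFourFrameU3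

end
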